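import Literature.AlgebraicGeometry.HodgeTheory.QuarticUnitaryTimesCMCurveWordParity
import Literature.AlgebraicGeometry.HodgeTheory.QuarticCMTwoOnePowersHodgeClasses
import Literature.AlgebraicGeometry.Motives.HodgeThetaAnnihilatorQuarticUnitaryTimesCMCurve
import HarnessLib

/-!
# `F × E`, `F` a simple abelian fourfold whose endomorphism algebra is a QUARTIC CM field acting with multiplicities `{(1,1),(2,0)}`, `E` ANY elliptic curve with complex multiplication: `B•(F × E) = D•(F × E)` and the Hodge conjecture for `F × E` (Moonen–Zarhin 1999 Thm. 0.2 (3) case (g) with `End⁰(X₂) ⊋ k`, §5 (5.11) Case 2, (5.12))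

Family `hodge`, layer `Literature/AlgebraicGeometry/HodgeTheory`. Research context: cell `pub-hodge-ring2` (HONEST
FRAMING: research route conditional on HC_CM; not a corollary; Q11.4-sentence-2 already refuted in dim ≥ 3),
Literature lane, programme R40 — the geometric file drawing the consequences of the Lie step
`Motives/HodgeThetaAnnihilatorQuarticUnitaryTimesCMCurve` (the annihilator of a Hodge class of `(H¹(F) ⊕ H¹(E))^{⊗}`
contains `ι_F [Y₁, Y₂] π_F` for all `Y₁, Y₂ ∈ 𝔲_K(H¹F, ψ)_ℂ ≅ 𝔤𝔩(W_{μ₁}) × 𝔤𝔩(W_{μ₂})`) and of the parity core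
`QuarticUnitaryTimesCMCurveWordParity`. It is the `End⁰(X₂) ⊋ k` companion of the tree's
`UnitaryTypeOneTimesCMCurveProductSpan` (R29: `End⁰(X₂) = k`), whose §3–§5 it follows line by line. UNCONDITIONAL (no
HC_CM); theorems only (no definition, no named fact, D-0026; nothing admitted); no step towards a summit statement
beyond the printed results it formalizes.

PRINTED RESULTS. B. Moonen, Yu. Zarhin, *Hodge classes on abelian varieties of low dimension*, Math. Ann. 315
(1999) 711–733 [held: `paper:arxiv-math_9901113`, locators = held TeX chunks]. Thm. 0.2 (chunks p0001–p0002), case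
(g): «The abelian variety `X` is isogenous to a product `X₁ × X₂` where `X₁` is an elliptic curve with complex
multiplication by an imaginary quadratic field `k` and where `X₂` is a simple abelian fourfold such that there exists
an embedding `k ↪ End⁰(X₂)` via which `k` acts on `T_{X₂,0}` with multiplicities `(1,3)`», and (3): «Suppose we are
in case (g). Then the Hodge ring `B•(X)` is generated by divisor classes, i.e., `B•(X) = D•(X)`». §5 (5.11) Case 2
(chunks p0010–p0011): «Suppose that `k` acts on `T_{Y,0}` with multiplicities `(1,3)` … Write `F = End⁰(Y)`, which
is a CM-field containing `k` … `Hg(X)` is contained in the subgroup `H = {(u₁,u₂) ∈ U_k × U_F(V_Y,ψ) ∣ u₁² · det_k(u₂)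
= 1}` … we conclude that `Hg(X) = H`». §5 (5.12) (chunk p0011): «Finally, suppose we are in case (g) … The only
interesting Künneth component in this case is `H¹(X₁,ℚ) ⊗ H³(X₂,ℚ)`. As we have shown, `Hg(X) = {(u₁,u₂) ∈ U_k ×
Hg(Y) ∣ u₁² · det_k(u₂) = 1}`. In particular we have an element `(-1,1) ∈ Hg(X)` which acts on `H¹(X₁,ℚ) ⊗
H³(X₂,ℚ)` as `-1`. This shows there are no Hodge classes in `H¹(X₁,ℚ) ⊗ H³(X₂,ℚ)` and that `B•(X)` is generated by
divisor classes.»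

THIS FILE (Lie-algebra form of `Hg(X) ⊇ {1} × [U_F(V_Y,ψ), U_F(V_Y,ψ)]`, `F = End⁰(Y)` a QUARTIC CM field acting with
multiplicities `(n_σ) = (1,1,2,0)` — the `F`-signature forced by «`k ⊂ F` acts with multiplicities `(1,3)`»). §3 THE
INVARIANCE THEOREM `AVSlots.exists_coeff_eq_zero_off_balanced_of_prod_quarticCM_cmCurve`: `Y` a SIMPLE fourfold with
`dim_ℚ End⁰(Y) = 4` and `φ ∈ End(Y)` acting on `H^{1,0}(Y)` with eigenvalues `μ₁, conj μ₁` (multiplicity `1` each) and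
`μ₂` (multiplicity `2`), `μ₁, conj μ₁, μ₂, conj μ₂` pairwise distinct (EXACTLY the hypotheses of the tree's
`AbelianVariety.isDivisorGenerated_of_quarticCM`); `E` an elliptic curve with `χ ≫ χ = -d'` (`d' > 0`; NO condition
relating `ℚ(χ)` and `End⁰(Y)` — the resonant case `k ⊂ F` included); `X` with ONE slot over `Y × E`: every rational
`(p,p)`-class on `X` has, in Hodge-adapted pair bases, a letter expansion vanishing off the `Y`-kind-balanced words
(the conclusion of R29's `AVSlots.exists_coeff_eq_zero_off_balanced_of_prod_unitaryTypeOne_cmCurve`, verbatim). Proof: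
R29's pipeline up to the antisymmetric kind-balanced coefficient function killed by the Hodge–theta algebra, the
quartic Lie step (loc. cit.) for the brackets `[P, P']` of the elementary `φ_ℂ`-commuting `ψ_ℂ`-skew operators
`P = E_{ij} ⊕ (-E_{ji})^t` of ONE colour on a quartic adapted `ψ_ℂ`-dual basis
(`HodgeStructure.QuarticTheta.exists_adaptedDualBasis`), whose brackets are the in-block root differences
`E_ii - E_jj` of `𝔰𝔩(W_{μ₁}) × 𝔰𝔩(W_{μ₂})`, then the PARITY core `sum_kindSign_inl_eq_zero_of_blockRootDiffWeights`
(blocks of size `2`): «`(-1,1)` acts as `-1`» read as «`-1 ∈ SU_F(V_Y)` acts as `(-1)^a` on `Λ^a H¹(Y)`». §4 the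
PRODUCT SPAN for one slot over `Y` and one over `E` and for `Y × E` (R29 §4 verbatim). §5 **`B•(Y × E) = D•(Y × E)`**
(product span + the tree's `AbelianVariety.isDivisorGenerated_of_quarticCM` + `dim E ≤ 3`), `E × Y`, THE HODGE
CONJECTURE FOR `Y × E` and for everything isogenous to it, the printed instance **Thm. 0.2 (3), case (g) with
`End⁰(X₂) = F` a quartic CM field of signature `{(1,1),(2,0)}`**
(`isDivisorGenerated_of_isIsogenous_cmCurve_prod_fourfold_caseG_quarticCM`), and **`B•(Y × E) = D•(Y × E)` with HC
for everything isogenous to `Y × E` for EVERY elliptic curve `E`** (`E` not of CM type by the tree's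
`TimesNonCMCurveProductSpan`, Lemma (3.4)).

SCOPE (numbers, not adjectives). Proved: `Y` simple, `dim Y = 4`, `dim_ℚ End⁰(Y) = 4`, one `φ ∈ End(Y)` with the
four distinct eigenvalues `μ₁, conj μ₁, μ₂, conj μ₂` of multiplicities `(1,1,2,0)` on `H^{1,0}(Y)`; `E` any elliptic
curve. NOT covered: the translation of the printed hypothesis «`k ↪ End⁰(X₂) = F` a quartic field, `k` acting with
multiplicities `(1,3)`» into these data (a separate bridge), `End⁰(X₂)` of degree `8` (`TODO(general form)`; for
`X₂` simple of dimension `4` with `k` central this cell is empty by parity, a Summit-side remark), the second sentence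
of Thm. 0.2 (3) («`Hg(X)` is strictly contained in `Sp_D(V,φ)`»), and more than ONE slot over `E` (Weil classes on
`E² × Y`, loc. cit. (5.11): nothing is asserted there).

## References

* [MoonenZarhin1999LowDim] B. Moonen, Yu. Zarhin, Math. Ann. 315 (1999), Thm. 0.2 (3) with case (g), §2 (2.3)–(2.4),
  §3 (3.1), §5 (5.11) Case 2, (5.12) (held `paper:arxiv-math_9901113` chunks p0001–p0002, p0005–p0006, p0010–p0011).
  [cite: MoonenZarhin1999LowDim, Thm. 0.2 (3) and §5 (5.11)–(5.12)]
* [MoonenZarhin1995Duke] B. Moonen, Yu. Zarhin, Duke Math. J. 77 (1995) 553–581 (`B(Yⁿ) = D(Yⁿ)` for the simple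
  fourfold `Y`, via MZ99 (2.4)). [cite: MoonenZarhin1995Duke, Thm. (0.2) for simple fourfolds (via MZ99 (2.4))]
* [Deligne1982HodgeCycles] P. Deligne, *Hodge cycles on abelian varieties*, LNM 900 (1982), I §3 Prop. 3.4.
  [cite: Deligne1982HodgeCycles, I §3 Prop. 3.4]
* [Lombardo2016] D. Lombardo, Ann. Inst. Fourier 66 (2016), Lemma 3.4 (p. 1229). [cite: Lombardo2016, Lemma 3.4 (p. 1229)]
* [GoodmanWallachGTM255] R. Goodman, N. Wallach, GTM 255, §4.1.1 (weights of the diagonal torus on tensor words).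
  [cite: GoodmanWallachGTM255, §4.1.1]
* [SilvermanAEC2009] J. H. Silverman, GTM 106 (2nd ed., 2009), III.9 Cor. 9.4. [cite: SilvermanAEC2009, III.9 Cor. 9.4]
* [Greub1978Multilinear] W. Greub, *Multilinear Algebra* (2nd ed., 1978), §4.2 (4.2). [cite: Greub1978Multilinear, §4.2 (4.2)]
* [vanGeemen1994HodgeAV] B. van Geemen, LNM 1594 (1994), §2.4–2.5, §3.6 (p. 236), Lemma 3.7.
  [cite: vanGeemen1994HodgeAV, §3.6 (p. 236) and Lemma 3.7]
-/

noncomputable section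

open scoped TensorProduct
open CategoryTheory Module

namespace Literature.AlgebraicGeometry.HodgeTheory

open Literature.AlgebraicTopology.SingularHomology
open Literature.AlgebraicGeometry.Motives (IsSmoothProjective AbelianVariety bettiCohomology
  ofRatClassBaseChange ofRatClassBaseChange_tmul HodgeTensorFacts hodgeTensorFacts_holds ComplexPoints)
open Literature.Barriers.HodgeConjecture
open Literature.AlgebraicGeometry.Motives.HodgeStructure
open Literature.AlgebraicGeometry.ComplexMultiplication
open Literature.RepresentationTheory.GeneralLinear
open Literature.NumberTheory.DiophantineGeometry

/-! ### §3 The invariance theorem for ONE slot over `Y × E`, `Y` of quartic CM type `{(1,1),(2,0)}` -/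

section Invariance

variable {Y E X : AbelianVariety ℂ} {g : Fin 1 → (X ⟶ Y.prod E)}

/-- The two elements of `Fin 2`. [folklore] -/
private theorem fin2_eq_zero_or_one_q (r : Fin 2) : r = 0 ∨ r = 1 := by
  fin_cases r <;> simp

/-- `[a]·x - [b]·x = ([a] - [b]) • x` with an integer scalar. [folklore] -/
private theorem ite_sub_ite_eq_cast_smul_q {M : Type*} [AddCommGroup M] [Module ℂ M] (a b : Prop) [Decidable a]
    [Decidable b] (x : M) :
    ((if a then x else 0) - (if b then x else 0)) =
      ((((if a then (1 : ℤ) else 0) - (if b then (1 : ℤ) else 0) : ℤ)) : ℂ) • x := by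
  split_ifs <;> simp

/-- The fibres of `Fin 4 ≃ Fin 2 × Fin 2 → Fin 2` (first projection) have two elements. [folklore] -/
private theorem even_card_filter_fst_finProdFinEquiv_symm (b : Fin 2) :
    Even (Finset.univ.filter fun L : Fin 4 => ((finProdFinEquiv (m := 2) (n := 2)).symm L).1 = b).card := by
  revert b
  decide

set_option maxHeartbeats 800000 in
open scoped Classical in
/-- **The INVARIANCE THEOREM for ONE slot over `Y × E`, `Y` a simple fourfold of quartic CM type `{(1,1),(2,0)}`, `E`
ANY elliptic curve with complex multiplication** (Moonen–Zarhin 1999 §5 (5.11) Case 2 / Thm. 0.2 (3) case (g) with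
`F = End⁰(Y) ⊋ k`: «`Hg(X) = {(u₁,u₂) ∈ U_k × U_F(V_Y,ψ) ∣ u₁² · det_k(u₂) = 1}` … an element `(-1, 1) ∈ Hg(X)` which
acts on `H¹(X₁) ⊗ H³(X₂)` as `-1`. This shows there are no Hodge classes in `H¹(X₁) ⊗ H³(X₂)` and that `B•(X)` is
generated by divisor classes»; Lie step `Motives/HodgeThetaAnnihilatorQuarticUnitaryTimesCMCurve`). Let `Y` be a
SIMPLE complex abelian fourfold with `dim_ℚ End⁰(Y) = 4` and `φ ∈ End(Y)` acting on `H^{1,0}(Y)` with eigenvalues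
`μ₁, conj μ₁` (multiplicity `1` each) and `μ₂` (multiplicity `2`), `μ₁, conj μ₁, μ₂, conj μ₂` pairwise distinct
(`End⁰(Y) = ℚ(φ)` a quartic CM field acting with multiplicities `(1,1,2,0)`), `E` an elliptic curve with `χ ≫ χ = -d'`
(`d' > 0`; `ℚ(χ)` may embed into `End⁰(Y)`), and `X` an abelian variety with ONE slot over `Y × E` (e.g. `X = Y ×
E`). Then there are Hodge-adapted pair bases of `H¹(Y) ⊗ ℂ` and `H¹(E) ⊗ ℂ` such that every rational `(p,p)`-class
on `X` has a letter expansion whose coefficient function VANISHES off the `Y`-kind-balanced words — the conclusion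
of the tree's `AVSlots.exists_coeff_eq_zero_off_balanced_of_prod_unitaryTypeOne_cmCurve` (R29, `End⁰(Y) = k`), so the
typed-Künneth pipeline applies verbatim. Proof: the antisymmetric kind-balanced coefficient function of the class is
killed by `Θ` and (quartic Lie step) by `ι_Y [Y₁, Y₂] π_Y` for all `Y₁, Y₂ ∈ 𝔲_F(H¹Y, ψ)_ℂ ≅ 𝔤𝔩(W_{μ₁}) × 𝔤𝔩(W_{μ₂})`,
in particular by the IN-BLOCK root differences `E_ii - E_jj` in a quartic adapted `ψ_ℂ`-dual basis (pairs grouped in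
two blocks of size `2`); on a word without repeated letters over ONE copy of `H¹(Y) ⊕ H¹(E)` these weights force an
even number of `Y`-letters, hence `Y`-kind balance (`sum_kindSign_inl_eq_zero_of_blockRootDiffWeights`: «`-1 ∈
SU_F(V_Y)` acts as `(-1)^a` on `Λ^a H¹(Y)`»). For TWO or more slots over `E` the conclusion fails (Weil classes on
`E² × Y`, loc. cit.: «`W_k ⊂ H⁶(Z,ℚ)` consists of Hodge classes»).
[cite: MoonenZarhin1999LowDim, §5 (5.11) Case 2 and (5.12)] [cite: MoonenZarhin1999LowDim, §2 (2.3) and §3 (3.1)]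
[cite: Deligne1982HodgeCycles, I §3 Prop. 3.4] [cite: Lombardo2016, Lemma 3.4 (p. 1229)]
[cite: GoodmanWallachGTM255, §4.1.1] -/
theorem AVSlots.exists_coeff_eq_zero_off_balanced_of_prod_quarticCM_cmCurve (hg : AVSlots (Y.prod E) X g)
    (hYs : Y.IsSimple) (φY : Y ⟶ Y) (hY4e : Module.finrank ℚ Y.endAlgebra = 4) {μ₁ μ₂ : ℂ}
    (h11 : starRingEnd ℂ μ₁ ≠ μ₁) (h22 : starRingEnd ℂ μ₂ ≠ μ₂) (h12 : μ₂ ≠ μ₁) (h12' : μ₂ ≠ starRingEnd ℂ μ₁)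
    (hm1 : eigenMultiplicity Y φY μ₁ = 1) (hm1' : eigenMultiplicity Y φY (starRingEnd ℂ μ₁) = 1)
    (hm2 : eigenMultiplicity Y φY μ₂ = 2) (hY4 : Y.dim = 4)
    (hE1 : E.dim = 1) (χ : E ⟶ E) {d' : ℕ} (hd' : 0 < d') (hχ : χ ≫ χ = -(d' • 𝟙 E)) :
    ∃ (hA : ℕ) (bA : Module.Basis (Fin hA × Fin 2) ℂ (ℂ ⊗[ℚ] bettiCohomology Y.X 1))
      (h : ℕ) (cC : Module.Basis (Fin h × Fin 2) ℂ (ℂ ⊗[ℚ] bettiCohomology E.X 1)),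
      (∀ i, IsOfHodgeType Y.dim Y.X 1 1 0 (ofRatClassBaseChange (Motives.ComplexPoints Y.X) 1 (bA (i, 0)))) ∧
      (∀ i, IsOfHodgeType Y.dim Y.X 1 0 1 (ofRatClassBaseChange (Motives.ComplexPoints Y.X) 1 (bA (i, 1)))) ∧
      (∀ i, IsOfHodgeType E.dim E.X 1 1 0 (ofRatClassBaseChange (Motives.ComplexPoints E.X) 1 (cC (i, 0)))) ∧
      (∀ i, IsOfHodgeType E.dim E.X 1 0 1 (ofRatClassBaseChange (Motives.ComplexPoints E.X) 1 (cC (i, 1)))) ∧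
      ∀ {p : ℕ}, 0 < p → ∀ {c : complexBetti X.X (2 * p)}, IsRationalClass c →
        IsOfHodgeType X.dim X.X (2 * p) p p c →
        ∃ a : (Fin (2 * p) → (Fin 1 × (Fin hA ⊕ Fin h)) × Fin 2) → ℂ,
          wordEval (cupPowOneAlt ℂ (Motives.ComplexPoints X.X) (2 * p))
            (fun jr : (Fin 1 × (Fin hA ⊕ Fin h)) × Fin 2 => complexBetti.map (g jr.1.1).hom.hom.hom 1
              (Sum.elim
                (fun i => complexBetti.map (Motives.AbelianVariety.fst Y E).hom.hom.hom 1
                  (ofRatClassBaseChange (Motives.ComplexPoints Y.X) 1 (bA (i, jr.2))))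
                (fun i => complexBetti.map (Motives.AbelianVariety.snd Y E).hom.hom.hom 1
                  (ofRatClassBaseChange (Motives.ComplexPoints E.X) 1 (cC (i, jr.2))))
                jr.1.2)) a = c ∧
          ∀ (U : Fin (2 * p) → Fin 1 × (Fin hA ⊕ Fin h)) (η : Fin (2 * p) → Fin 2),
            (∑ t, Sum.elim (fun _ : Fin hA => if η t = 0 then (1 : ℂ) else -1) (fun _ : Fin h => (0 : ℂ)) (U t).2) ≠ 0 →
            a (fun t => (U t, η t)) = 0 := by
  classical
  -- the setting
  have hHD : exists_isReal_hodgeModel := exists_isReal_hodgeModel_holds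
  have hI : hodgePQ_independent_of_hodgeModel := hodgePQ_independent_of_hodgeModel_holds
  haveI : HodgeTensorFacts.{0, 0} := hodgeTensorFacts_holds.{0, 0}
  have hXA : IsSmoothProjective Y.dim Y.X := AbelianVariety.isSmoothProjective_holds
  have hXC : IsSmoothProjective E.dim E.X := AbelianVariety.isSmoothProjective_holds
  have hXP : IsSmoothProjective (Y.prod E).dim (Y.prod E).X := AbelianVariety.isSmoothProjective_holds
  haveI : Module.Finite ℚ (bettiCohomology Y.X 1) := finite_bettiCohomology_one Y
  haveI : Module.Finite ℚ (bettiCohomology E.X 1) := finite_bettiCohomology_one E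
  haveI : Module.Finite ℚ (bettiCohomology (Y.prod E).X 1) := finite_bettiCohomology_one (Y.prod E)
  have hn1 : (((1 : ℕ) : ℤ)) = 1 := by norm_num
  have heffA := BettiUniverse.hodge_isEffective hHD hXA 1
  have heffC := BettiUniverse.hodge_isEffective hHD hXC 1
  -- polarizations of `H¹(Y)`, `H¹(E)`
  obtain ⟨ψ⟩ : (BettiUniverse.hodge hHD (AbelianVariety.isSmoothProjective_holds (A := Y)) 1).IsPolarizable :=
    smoothProjective_hodgeStructure_isPolarizable_holds hXA (BettiUniverse.realHodgeModel hHD hXA)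
      (BettiUniverse.realHodgeModel_isHodgeSymmetric hHD hXA) 1
  obtain ⟨ψC⟩ : (BettiUniverse.hodge hHD (AbelianVariety.isSmoothProjective_holds (A := E)) 1).IsPolarizable :=
    smoothProjective_hodgeStructure_isPolarizable_holds hXC (BettiUniverse.realHodgeModel hHD hXC)
      (BettiUniverse.realHodgeModel_isHodgeSymmetric hHD hXC) 1
  -- the quartic data of `H¹(Y)`: `φ^*`, `End_Hdg = ℚ[φ^*]` a division ring, `μ = (μ₁, μ₂)`, multiplicities `(1,1,2,·)`
  set φQ : Module.End ℚ (bettiCohomology Y.X 1) := (bettiCohomology.map φY.hom.hom.hom 1).hom with hφQ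
  have hφE : φQ ∈ (BettiUniverse.hodge hHD (AbelianVariety.isSmoothProjective_holds (A := Y)) 1).endAlg :=
    pullback_mem_endAlg hHD hI φY
  have hV : Module.finrank ℚ (bettiCohomology Y.X 1) = 8 := finrank_bettiCohomology_one_of_dim_four hY4
  set μ : Fin 2 → ℂ := ![μ₁, μ₂] with hμ
  have hμ0 : μ 0 = μ₁ := rfl
  have hμ1 : μ 1 = μ₂ := rfl
  have h1a : Module.finrank ℂ ↥(Module.End.eigenspace (φQ.baseChange ℂ) (μ 0) ⊓
      (BettiUniverse.hodge hHD (AbelianVariety.isSmoothProjective_holds (A := Y)) 1).piece 1 0) = 1 := by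
    rw [hμ0, hφQ, finrank_eigenspace_inf_piece_oneZero_eq_eigenMultiplicity hHD hI φY μ₁, hm1]
  have h1b : Module.finrank ℂ ↥(Module.End.eigenspace (φQ.baseChange ℂ) (μ 0) ⊓
      (BettiUniverse.hodge hHD (AbelianVariety.isSmoothProjective_holds (A := Y)) 1).piece 0 1) = 1 := by
    rw [hμ0, hφQ, finrank_eigenspace_inf_piece_zeroOne_eq_eigenMultiplicity_conj hHD hI φY μ₁, hm1']
  have h2a : Module.finrank ℂ ↥(Module.End.eigenspace (φQ.baseChange ℂ) (μ 1) ⊓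
      (BettiUniverse.hodge hHD (AbelianVariety.isSmoothProjective_holds (A := Y)) 1).piece 1 0) = 2 := by
    rw [hμ1, hφQ, finrank_eigenspace_inf_piece_oneZero_eq_eigenMultiplicity hHD hI φY μ₂, hm2]
  have h2b : Module.finrank ℂ ↥(Module.End.eigenspace (φQ.baseChange ℂ) (starRingEnd ℂ μ₂) ⊓
      (BettiUniverse.hodge hHD (AbelianVariety.isSmoothProjective_holds (A := Y)) 1).piece 0 1) = 2 := by
    rw [hφQ, finrank_eigenspace_inf_piece_zeroOne_eq_eigenMultiplicity_conj hHD hI φY, starRingEnd_self_apply, hm2]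
  have h1c : Module.finrank ℂ ↥(Module.End.eigenspace (φQ.baseChange ℂ) (starRingEnd ℂ μ₁) ⊓
      (BettiUniverse.hodge hHD (AbelianVariety.isSmoothProjective_holds (A := Y)) 1).piece 1 0) = 1 := by
    rw [hφQ, finrank_eigenspace_inf_piece_oneZero_eq_eigenMultiplicity hHD hI φY, hm1']
  have hne : ∀ (S T : Submodule ℂ (ℂ ⊗[ℚ] bettiCohomology Y.X 1)) (m : ℕ),
      Module.finrank ℂ ↥(S ⊓ T) = m → m ≠ 0 → S ≠ ⊥ := by
    intro S T m hm hm0 hS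
    apply hm0
    rw [← hm, hS, bot_inf_eq, finrank_bot]
  set cμ : Fin 4 → ℂ := ![μ₁, starRingEnd ℂ μ₁, μ₂, starRingEnd ℂ μ₂] with hcμ
  have h21 : starRingEnd ℂ μ₂ ≠ μ₁ := fun h => h12' (by rw [← h, starRingEnd_self_apply])
  have hcinj : Function.Injective cμ := by
    intro i j hij
    fin_cases i <;> fin_cases j
    all_goals simp [hcμ] at hij
    all_goals first
      | rfl
      | exact absurd hij h11.symm | exact absurd hij h11 | exact absurd hij h12.symm | exact absurd hij h12
      | exact absurd hij h21.symm | exact absurd hij h21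
      | exact absurd hij (fun h => h12' (by rw [← h, starRingEnd_self_apply]))
      | exact absurd hij (fun h => h12' (by rw [h, starRingEnd_self_apply]))
      | exact absurd hij (fun h => h12 (RingHom.injective _ h))
      | exact absurd hij (fun h => h12 (RingHom.injective _ h).symm)
      | exact absurd hij h12' | exact absurd hij h12'.symm
      | exact absurd hij h22 | exact absurd hij h22.symm
  have hW : ∀ j, Module.End.eigenspace (φQ.baseChange ℂ) (cμ j) ≠ ⊥ := by
    intro j
    fin_cases j
    · exact hne _ _ 1 (hμ0 ▸ h1a) one_ne_zero
    · exact hne _ _ 1 h1c one_ne_zero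
    · exact hne _ _ 2 (hμ1 ▸ h2a) two_ne_zero
    · exact hne _ _ 2 h2b two_ne_zero
  have hE := exists_eq_sum_smul_pow_bettiMapHom hHD hI φY hY4e cμ hcinj hW
  have hdiv := exists_mul_eq_one_of_mem_endAlg_of_isSimple hHD hI hYs
  have h11' : starRingEnd ℂ (μ 0) ≠ μ 0 := by rw [hμ0]; exact h11
  have h22' : starRingEnd ℂ (μ 1) ≠ μ 1 := by rw [hμ1]; exact h22
  have h12μ : μ 1 ≠ μ 0 := by rw [hμ0, hμ1]; exact h12
  have h12μ' : μ 1 ≠ starRingEnd ℂ (μ 0) := by rw [hμ0, hμ1]; exact h12'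
  -- adapted `ψ_ℂ`-dual bases `cb ((k, t), ℓ)` (colour `k`, type `t`, member `ℓ`) of `H¹(Y) ⊗ ℂ = ⊕_c W_c`, kinds `κ`
  obtain ⟨cb, κ, hcbW, hcbW', hcb0, hcb1, hdual, hiso⟩ := QuarticTheta.exists_adaptedDualBasis
    (BettiUniverse.hodge hHD (AbelianVariety.isSmoothProjective_holds (A := Y)) 1) Nat.cast_one heffA ψ hφE hE
    μ h11' h22' h12μ h12μ' hV h1a h1b h2a
  -- the same basis in PAIR format: pairs `L : Fin 4 ≃ (colour, member)`, `bY (L, r) = cb ((k, if r = κ then 0 else 1), ℓ)`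
  set e : Fin 2 × Fin 2 ≃ Fin 4 := finProdFinEquiv with he
  set τ : Fin 4 × Fin 2 ≃ (Fin 2 × Fin 2) × Fin 2 :=
    { toFun := fun Lr => (((e.symm Lr.1).1, if Lr.2 = κ (e.symm Lr.1) then 0 else 1), (e.symm Lr.1).2)
      invFun := fun x => (e (x.1.1, x.2),
        if x.1.2 = 0 then κ (x.1.1, x.2) else (if κ (x.1.1, x.2) = 0 then 1 else 0))
      left_inv := by
        rintro ⟨L, r⟩
        have hL : e ((e.symm L).1, (e.symm L).2) = L := by rw [Prod.mk.eta, Equiv.apply_symm_apply]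
        rcases fin2_eq_zero_or_one_q r with hr | hr <;>
          rcases fin2_eq_zero_or_one_q (κ (e.symm L)) with hk | hk <;> simp [hr, hk, hL]
      right_inv := by
        rintro ⟨⟨k, t⟩, ℓ⟩
        rcases fin2_eq_zero_or_one_q t with ht | ht <;>
          rcases fin2_eq_zero_or_one_q (κ (k, ℓ)) with hk | hk <;> simp [ht, hk] } with hτ
  set bY : Module.Basis (Fin 4 × Fin 2) ℂ (ℂ ⊗[ℚ] bettiCohomology Y.X 1) := cb.reindex τ.symm with hbYdef
  have hbY : ∀ L r, bY (L, r) = cb (((e.symm L).1, if r = κ (e.symm L) then 0 else 1), (e.symm L).2) := fun L r => by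
    rw [hbYdef, Module.Basis.reindex_apply, Equiv.symm_symm]
    rfl
  have hbY0' : ∀ L, bY (L, 0) ∈ (BettiUniverse.hodge hHD hXA 1).piece 1 0 := by
    intro L
    rw [hbY]
    rcases fin2_eq_zero_or_one_q (κ (e.symm L)) with hk | hk
    · rw [hk, if_pos rfl]; exact (hcb0 _ _ (by rw [Prod.mk.eta]; exact hk)).1
    · rw [hk, if_neg (by decide)]; exact (hcb1 _ _ (by rw [Prod.mk.eta]; exact hk)).2
  have hbY1' : ∀ L, bY (L, 1) ∈ (BettiUniverse.hodge hHD hXA 1).piece 0 1 := by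
    intro L
    rw [hbY]
    rcases fin2_eq_zero_or_one_q (κ (e.symm L)) with hk | hk
    · rw [hk, if_neg (by decide)]; exact (hcb0 _ _ (by rw [Prod.mk.eta]; exact hk)).2
    · rw [hk, if_pos rfl]; exact (hcb1 _ _ (by rw [Prod.mk.eta]; exact hk)).1
  -- the pair basis of `H¹(E) ⊗ ℂ`
  obtain ⟨h, cC, hcC0, hcC1⟩ := exists_hodgeAdapted_pairBasis (BettiUniverse.hodge hHD hXC 1) (by norm_num) heffC
  have hcC0' : ∀ i, cC (i, 0) ∈ (BettiUniverse.hodge hHD hXC 1).piece 1 0 := fun i => by simpa using hcC0 i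
  have hcC1' : ∀ i, cC (i, 1) ∈ (BettiUniverse.hodge hHD hXC 1).piece 0 1 := fun i => by simpa using hcC1 i
  refine ⟨4, bY, h, cC, fun i => ?_, fun i => ?_, fun i => ?_, fun i => ?_, ?_⟩
  · exact (BettiUniverse.mem_hodge_piece_iff hHD hI hXA (k := 1) (p := 1) (q := 0) rfl _).1 (hbY0' i)
  · exact (BettiUniverse.mem_hodge_piece_iff hHD hI hXA (k := 1) (p := 0) (q := 1) rfl _).1 (hbY1' i)
  · exact (BettiUniverse.mem_hodge_piece_iff hHD hI hXC (k := 1) (p := 1) (q := 0) rfl _).1 (hcC0' i)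
  · exact (BettiUniverse.mem_hodge_piece_iff hHD hI hXC (k := 1) (p := 0) (q := 1) rfl _).1 (hcC1' i)
  intro p hp c hcQ hc
  -- COUNTS: `h = 1` (`dim E = 1`); the two blocks (colours) of pairs have two members each
  have hh1 : h = 1 := by
    have hcard := Module.finrank_eq_card_basis cC
    rw [Module.finrank_baseChange, finrank_bettiCohomology_one E, hE1, Fintype.card_prod, Fintype.card_fin,
      Fintype.card_fin] at hcard
    omega
  have hβ : ∀ b : Fin 2, Even (Finset.univ.filter fun L : Fin 4 => (e.symm L).1 = b).card := fun b => by
    rw [he]; exact even_card_filter_fst_finProdFinEquiv_symm b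
  -- the presentation `H¹(Y × E) = pr_Y^* H¹(Y) ⊕ pr_E^* H¹(E)` and its complexification
  set ι₁ := HOneProduct.pullFst Y E with hι₁
  set π₁ := HOneProduct.pullInl Y E with hπ₁
  set ι₂ := HOneProduct.pullSnd Y E with hι₂
  set π₂ := HOneProduct.pullInr Y E with hπ₂
  have hπι₁ : π₁ ∘ₗ ι₁ = LinearMap.id := HOneProduct.pullInl_comp_pullFst
  have hπι₂ : π₂ ∘ₗ ι₂ = LinearMap.id := HOneProduct.pullInr_comp_pullSnd
  have hπ₁ι₂ : π₁ ∘ₗ ι₂ = 0 := HOneProduct.pullInl_comp_pullSnd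
  have hπ₂ι₁ : π₂ ∘ₗ ι₁ = 0 := HOneProduct.pullInr_comp_pullFst
  have hsum : ι₁ ∘ₗ π₁ + ι₂ ∘ₗ π₂ = LinearMap.id := HOneProduct.pullFst_comp_pullInl_add
  have hπι₁C : π₁.baseChange ℂ ∘ₗ ι₁.baseChange ℂ = LinearMap.id := by
    rw [← LinearMap.baseChange_comp, hπι₁, LinearMap.baseChange_id]
  have hπι₂C : π₂.baseChange ℂ ∘ₗ ι₂.baseChange ℂ = LinearMap.id := by
    rw [← LinearMap.baseChange_comp, hπι₂, LinearMap.baseChange_id]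
  have hπ₁ι₂C : π₁.baseChange ℂ ∘ₗ ι₂.baseChange ℂ = 0 := by
    rw [← LinearMap.baseChange_comp, hπ₁ι₂, LinearMap.baseChange_zero]
  have hπ₂ι₁C : π₂.baseChange ℂ ∘ₗ ι₁.baseChange ℂ = 0 := by
    rw [← LinearMap.baseChange_comp, hπ₂ι₁, LinearMap.baseChange_zero]
  have hsumC : ι₁.baseChange ℂ ∘ₗ π₁.baseChange ℂ + ι₂.baseChange ℂ ∘ₗ π₂.baseChange ℂ = LinearMap.id := by
    rw [← LinearMap.baseChange_comp, ← LinearMap.baseChange_comp, ← LinearMap.baseChange_add, hsum,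
      LinearMap.baseChange_id]
  have e11 : ∀ x, π₁.baseChange ℂ (ι₁.baseChange ℂ x) = x := fun x => by
    rw [← LinearMap.comp_apply (f := π₁.baseChange ℂ), hπι₁C, LinearMap.id_apply]
  have e12 : ∀ y, π₁.baseChange ℂ (ι₂.baseChange ℂ y) = 0 := fun y => by
    rw [← LinearMap.comp_apply (f := π₁.baseChange ℂ), hπ₁ι₂C, LinearMap.zero_apply]
  -- piece compatibility of `pr_Y^*`, `pr_E^*`
  have hι₁F : ∀ q : ℤ, ∀ x ∈ (BettiUniverse.hodge hHD hXA 1).piece q (((1 : ℕ) : ℤ) - q),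
      ι₁.baseChange ℂ x ∈ (BettiUniverse.hodge hHD hXP 1).piece q (((1 : ℕ) : ℤ) - q) :=
    fun q x hx => (BettiUniverse.pullHodgeHom hHD hI hXP hXA (Motives.AbelianVariety.fst Y E).hom.hom.hom 1).map_piece_le
      q _ ⟨x, hx, rfl⟩
  have hι₂F : ∀ q : ℤ, ∀ x ∈ (BettiUniverse.hodge hHD hXC 1).piece q (((1 : ℕ) : ℤ) - q),
      ι₂.baseChange ℂ x ∈ (BettiUniverse.hodge hHD hXP 1).piece q (((1 : ℕ) : ℤ) - q) :=
    fun q x hx => (BettiUniverse.pullHodgeHom hHD hI hXP hXC (Motives.AbelianVariety.snd Y E).hom.hom.hom 1).map_piece_le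
      q _ ⟨x, hx, rfl⟩
  -- the basis `cbx` of `H¹(Y × E) ⊗ ℂ` in pairs: `pr_Y^* bY_L^r` and `pr_E^* c_i^r`
  obtain ⟨cbx', hcbx'l, hcbx'r⟩ := exists_basis_of_presentation hπι₁C hπι₂C hπ₁ι₂C hπ₂ι₁C hsumC bY cC
  set cbx : Module.Basis ((Fin 4 ⊕ Fin h) × Fin 2) ℂ (ℂ ⊗[ℚ] bettiCohomology (Y.prod E).X 1) :=
    cbx'.reindex (Equiv.sumProdDistrib (Fin 4) (Fin h) (Fin 2)).symm with hcbxdef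
  have hcbx : ∀ tr : (Fin 4 ⊕ Fin h) × Fin 2, cbx tr =
      Sum.elim (fun i => ι₁.baseChange ℂ (bY (i, tr.2))) (fun i => ι₂.baseChange ℂ (cC (i, tr.2))) tr.1 := by
    rintro ⟨t, r⟩
    rw [hcbxdef, Module.Basis.reindex_apply, Equiv.symm_symm]
    rcases t with i | i
    · rw [Equiv.sumProdDistrib_apply_left, hcbx'l]; rfl
    · rw [Equiv.sumProdDistrib_apply_right, hcbx'r]; rfl
  -- Hodge-adaptedness of `cbx`
  have hcbx0 : ∀ t, cbx (t, 0) ∈ (BettiUniverse.hodge hHD hXP 1).piece 1 0 := by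
    intro t
    rw [hcbx]
    rcases t with i | i
    · have e : (((1 : ℕ) : ℤ) - 1) = 0 := by norm_num
      have h10 := hι₁F 1 _ (by rw [e]; exact hbY0' i)
      rwa [e] at h10
    · have e : (((1 : ℕ) : ℤ) - 1) = 0 := by norm_num
      have h10 := hι₂F 1 _ (by rw [e]; exact hcC0' i)
      rwa [e] at h10
  have hcbx1 : ∀ t, cbx (t, 1) ∈ (BettiUniverse.hodge hHD hXP 1).piece 0 1 := by
    intro t
    rw [hcbx]
    rcases t with i | i
    · have e : (((1 : ℕ) : ℤ) - 0) = 1 := by norm_num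
      have h01 := hι₁F 0 _ (by rw [e]; exact hbY1' i)
      rwa [e] at h01
    · have e : (((1 : ℕ) : ℤ) - 0) = 1 := by norm_num
      have h01 := hι₂F 0 _ (by rw [e]; exact hcC1' i)
      rwa [e] at h01
  -- bases indexed by `Fin M`: the pair basis `cbσ` and the rational basis `eC`
  set eQ := Module.finBasis ℚ (bettiCohomology (Y.prod E).X 1) with heQ
  set eC : Module.Basis (Fin (Module.finrank ℚ (bettiCohomology (Y.prod E).X 1))) ℂ
    (ℂ ⊗[ℚ] bettiCohomology (Y.prod E).X 1) := Algebra.TensorProduct.basis ℂ eQ with heC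
  set φ : Fin (Module.finrank ℚ (bettiCohomology (Y.prod E).X 1)) ≃ (Fin 4 ⊕ Fin h) × Fin 2 :=
    eC.indexEquiv cbx with hφ
  set cbσ : Module.Basis (Fin (Module.finrank ℚ (bettiCohomology (Y.prod E).X 1))) ℂ
    (ℂ ⊗[ℚ] bettiCohomology (Y.prod E).X 1) := cbx.reindex φ.symm with hcbσdef
  have hcbσ : ∀ m, cbσ m = cbx (φ m) := fun m => by
    rw [hcbσdef, Module.Basis.reindex_apply, Equiv.symm_symm]
  -- letters
  set ρ := ofRatClassBaseChangeEquiv hXP 1 with hρ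
  set v : Module.Basis _ ℂ (complexBetti (Y.prod E).X 1) := cbσ.map ρ with hv
  set eL : Module.Basis _ ℂ (complexBetti (Y.prod E).X 1) := eC.map ρ with heL
  have heLQ : ∀ i, IsRationalClass (eL i) := fun i => by
    rw [heL, Module.Basis.map_apply, heC, Algebra.TensorProduct.basis_apply, hρ,
      ofRatClassBaseChangeEquiv_apply, ofRatClassBaseChange_tmul, one_smul]
    exact isRationalClass_ofRatClass _
  set κ' : Fin (Module.finrank ℚ (bettiCohomology (Y.prod E).X 1)) → Fin 2 := fun m => (φ m).2 with hκ'
  have hv_apply : ∀ m, v m = ofRatClassBaseChange (Motives.ComplexPoints (Y.prod E).X) 1 (cbx (φ m)) := fun m => by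
    rw [hv, Module.Basis.map_apply, hcbσ, hρ, ofRatClassBaseChangeEquiv_apply]
  have hv0 : ∀ m, κ' m = 0 → IsOfHodgeType (Y.prod E).dim (Y.prod E).X 1 1 0 (v m) := by
    intro m hm
    rw [hv_apply, ← BettiUniverse.mem_hodge_piece_iff hHD hI hXP (k := 1) (p := 1) (q := 0) rfl]
    have hsplit : φ m = ((φ m).1, 0) := by
      change (φ m).2 = 0 at hm; rw [← hm]
    rw [hsplit]
    exact hcbx0 _
  have hv1 : ∀ m, κ' m = 1 → IsOfHodgeType (Y.prod E).dim (Y.prod E).X 1 0 1 (v m) := by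
    intro m hm
    rw [hv_apply, ← BettiUniverse.mem_hodge_piece_iff hHD hI hXP (k := 1) (p := 0) (q := 1) rfl]
    have hsplit : φ m = ((φ m).1, 1) := by
      change (φ m).2 = 1 at hm; rw [← hm]
    rw [hsplit]
    exact hcbx1 _
  -- (α) an antisymmetric kind-balanced coefficient function in the adapted letters
  obtain ⟨ax, hax_bal, hax_anti, hcax⟩ := hg.exists_antisymm_kindBalanced_wordEval_eq v κ' hv0 hv1 hp hc
  -- the change of letters to the rational letters
  set G : Matrix _ _ ℂ := eC.toMatrix cbσ with hG
  set G' : Matrix _ _ ℂ := cbσ.toMatrix eC with hG'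
  have hG'G : G' * G = 1 := cbσ.toMatrix_mul_toMatrix_flip eC
  have hve : ∀ m, v m = ∑ i, G i m • eL i := fun m => by
    simp only [hv, heL, Module.Basis.map_apply, ← map_smul, ← map_sum]
    congr 1
    exact (eC.sum_toMatrix_smul_self (v := ⇑cbσ) (j := m)).symm
  have hletters : ∀ j m, avLetters g v (j, m) = ∑ i, G i m • avLetters g eL (j, i) :=
    avLetters_baseChange g G hve
  set aE := colourChangeAt (fun _ : Fin 1 => G) ax with haE
  have haE_anti : IsAntisymm aE := hax_anti.colourChangeAt _
  have hcaE : wordEval (cupPowOneAlt ℂ (Motives.ComplexPoints X.X) (2 * p)) (avLetters g eL) aE = c := by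
    rw [haE, ← wordEval_eq_wordEval_colourChangeAt _ (fun _ : Fin 1 => G) hletters ax, hcax]
  -- rationality of `aE`
  have hFinj : Function.Injective (exteriorPower.alternatingMapLinearEquiv
      (cupPowOneAlt ℂ (Motives.ComplexPoints X.X) (2 * p))) :=
    injective_alternatingMapLinearEquiv_cupPowOneAlt X (2 * p)
  obtain ⟨q, hq⟩ := hg.exists_rat_wordEval_eq eL heLQ hcQ
  obtain ⟨q', -, haEq⟩ := haE_anti.exists_eq_algebraMap_of_wordEval_eq hFinj (hg.letterBasis eL)
    (q := q) (by rw [AVSlots.coe_letterBasis, hcaE, hq])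
  have hslice_e : ∀ u, wordSlice aE u = wordRepAt ℂ (fun _ : Fin (2 * p) => G) (wordSlice ax u) :=
    fun u => wordSlice_colourChangeAt (fun _ : Fin 1 => G) ax u
  -- the Hodge operator `Θ` of `H¹(Y × E)`: `diag(±1)` in the adapted letters
  obtain ⟨Θ, hΘ⟩ := exists_hodgeTheta (BettiUniverse.hodge hHD hXP 1)
  have hΘb : ∀ m, Θ (cbσ m) = (if κ' m = 0 then (1 : ℂ) else -1) • cbσ m := by
    intro m
    rw [hcbσ]
    change Θ _ = (if (φ m).2 = 0 then (1 : ℂ) else -1) • _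
    rcases fin2_eq_zero_or_one_q (φ m).2 with h0 | h1
    · rw [h0, if_pos rfl]
      have hmem : cbx (φ m) ∈ (BettiUniverse.hodge hHD hXP 1).piece 1 (((1 : ℕ) : ℤ) - 1) := by
        have e : (((1 : ℕ) : ℤ) - 1) = 0 := by norm_num
        have hsplit : φ m = ((φ m).1, 0) := by rw [← h0]
        rw [e, hsplit]; exact hcbx0 _
      rw [hΘ 1 _ hmem]
      norm_num
    · rw [h1, if_neg one_ne_zero]
      have hmem : cbx (φ m) ∈ (BettiUniverse.hodge hHD hXP 1).piece 0 (((1 : ℕ) : ℤ) - 0) := by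
        have e : (((1 : ℕ) : ℤ) - 0) = 1 := by norm_num
        have hsplit : φ m = ((φ m).1, 1) := by rw [← h1]
        rw [e, hsplit]; exact hcbx1 _
      rw [hΘ 0 _ hmem]
      norm_num
  have hΘcb : LinearMap.toMatrix cbσ cbσ Θ = kindDiag κ' := by
    ext i m
    rw [LinearMap.toMatrix_apply, hΘb, map_smul, Module.Basis.repr_self, Finsupp.smul_apply,
      Finsupp.single_apply, kindDiag, Matrix.diagonal_apply, smul_eq_mul, mul_ite, mul_one, mul_zero]
    by_cases him : i = m
    · subst him; rw [if_pos rfl]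
    · rw [if_neg (Ne.symm him), if_neg him]
  have hJG : LinearMap.toMatrix eC eC Θ * G = G * kindDiag κ' := by
    rw [← hΘcb, hG, linearMap_toMatrix_mul_basis_toMatrix, basis_toMatrix_mul_linearMap_toMatrix]
  have hΘq : ∀ u : Fin (2 * p) → Fin 1, wordDerAt ℂ (fun _ : Fin (2 * p) => LinearMap.toMatrix eC eC Θ)
      (wordSlice (fun w => algebraMap ℚ ℂ (q' w)) u) = 0 := by
    intro u
    rw [← haEq, hslice_e]
    refine wordDerAt_wordRepAt_eq_zero_of_mul_eq ℂ (fun _ : Fin (2 * p) => G) (fun _ => hJG) ?_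
    rw [wordDerAt_const]
    exact wordDer_kindDiag_wordSlice_eq_zero κ' hax_bal u
  -- the Hodge operators `Θ_Y`, `Θ_E`, and the data of the CM curve
  obtain ⟨ΘA, hΘA⟩ := exists_hodgeTheta (BettiUniverse.hodge hHD hXA 1)
  obtain ⟨ΘC, hΘC⟩ := exists_hodgeTheta (BettiUniverse.hodge hHD hXC 1)
  have hχE := pullback_mem_endAlg hHD hI χ
  have hχ2 : (bettiCohomology.map χ.hom.hom.hom 1).hom * (bettiCohomology.map χ.hom.hom.hom 1).hom =
      -((d' : ℚ) • 1) := bettiMapHom_mul_self hχ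
  have hd'Q : (0 : ℚ) < d' := Nat.cast_pos.2 hd'
  have hV₂ : Module.finrank ℚ (bettiCohomology E.X 1) = 2 := by rw [finrank_bettiCohomology_one E, hE1]
  -- structure constants of `ψ_ℂ` and `φ_ℂ` in the adapted basis
  set Ψ := ψ.form.baseChange ℂ with hΨ
  have hswap : ∀ x y, Ψ y x = -Ψ x y := fun x y => by
    rw [hΨ, ψ.form_baseChange_swap, show (((1 : ℕ) : ℤ)).negOnePow = -1 from Int.negOnePow_one]
    simp
  have hdual_same : ∀ k i j, Ψ (cb ((k, 0), i)) (cb ((k, 1), j)) = if i = j then 1 else 0 := fun k i j => by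
    rw [hΨ, hdual]; simp
  have hswap_same : ∀ k i j, Ψ (cb ((k, 1), i)) (cb ((k, 0), j)) = -(if j = i then 1 else 0) := fun k i j => by
    rw [hswap, hdual_same]
  have hiso' : ∀ k k' (t : Fin 2) i j, Ψ (cb ((k, t), i)) (cb ((k', t), j)) = 0 := fun k k' t i j => by
    rw [hΨ]; exact hiso k k' t i j
  have hpair0 : ∀ k₁ k₂ (t₁ t₂ : Fin 2) i j, k₁ ≠ k₂ → Ψ (cb ((k₁, t₁), i)) (cb ((k₂, t₂), j)) = 0 := by
    intro k₁ k₂ t₁ t₂ i j hk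
    rcases fin2_eq_zero_or_one_q t₁ with rfl | rfl <;> rcases fin2_eq_zero_or_one_q t₂ with rfl | rfl
    · exact hiso' k₁ k₂ 0 i j
    · rw [hΨ, hdual, if_neg (fun h => hk h.1)]
    · rw [hswap, hΨ, hdual, if_neg (fun h => hk h.1.symm), neg_zero]
    · exact hiso' k₁ k₂ 1 i j
  set ev : Fin 2 × Fin 2 → ℂ := fun kt => if kt.2 = 0 then μ kt.1 else starRingEnd ℂ (μ kt.1) with hev
  have hφcb : ∀ (kt : Fin 2 × Fin 2) ℓ, φQ.baseChange ℂ (cb (kt, ℓ)) = ev kt • cb (kt, ℓ) := by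
    rintro ⟨k, t⟩ ℓ
    rcases fin2_eq_zero_or_one_q t with rfl | rfl
    · simp only [hev, if_pos rfl]; exact Module.End.mem_eigenspace_iff.1 (hcbW k ℓ)
    · simp only [hev, if_neg one_ne_zero]; exact Module.End.mem_eigenspace_iff.1 (hcbW' k ℓ)
  -- the elementary operators `P^k_{ij} ∈ 𝔲_F(H¹Y, ψ)_ℂ ≅ 𝔤𝔩(W_{μ 0}) × 𝔤𝔩(W_{μ 1})`: `e^k_j ↦ e^k_i`, `f^k_i ↦ -f^k_j`, `0` on the other colour
  have hops : ∀ (k : Fin 2) (i j : Fin 2), ∃ P : Module.End ℂ (ℂ ⊗[ℚ] bettiCohomology Y.X 1),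
      (∀ ℓ, P (cb ((k, 0), ℓ)) = if ℓ = j then cb ((k, 0), i) else 0) ∧
      (∀ ℓ, P (cb ((k, 1), ℓ)) = if ℓ = i then -cb ((k, 1), j) else 0) ∧
      (∀ k' (t : Fin 2) ℓ, k' ≠ k → P (cb ((k', t), ℓ)) = 0) ∧
      P * φQ.baseChange ℂ = φQ.baseChange ℂ * P ∧ (∀ x y, Ψ (P x) y + Ψ x (P y) = 0) := by
    intro k i j
    set P : Module.End ℂ (ℂ ⊗[ℚ] bettiCohomology Y.X 1) := cb.constr ℂ (fun x : (Fin 2 × Fin 2) × Fin 2 =>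
      if x.1.1 = k then (if x.1.2 = 0 then (if x.2 = j then cb ((k, 0), i) else 0)
        else (if x.2 = i then -cb ((k, 1), j) else 0)) else 0) with hPdef
    have hP0 : ∀ ℓ, P (cb ((k, 0), ℓ)) = if ℓ = j then cb ((k, 0), i) else 0 := fun ℓ => by
      rw [hPdef, Module.Basis.constr_basis]; simp
    have hP1 : ∀ ℓ, P (cb ((k, 1), ℓ)) = if ℓ = i then -cb ((k, 1), j) else 0 := fun ℓ => by
      rw [hPdef, Module.Basis.constr_basis]; simp
    have hPne : ∀ k' (t : Fin 2) ℓ, k' ≠ k → P (cb ((k', t), ℓ)) = 0 := fun k' t ℓ hk' => by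
      rw [hPdef, Module.Basis.constr_basis]; simp [hk']
    have hPt : ∀ (kt : Fin 2 × Fin 2) ℓ, ∃ s : ℂ, ∃ ℓ' : Fin 2, P (cb (kt, ℓ)) = s • cb (kt, ℓ') := by
      rintro ⟨k', t⟩ ℓ
      by_cases hk' : k' = k
      · subst hk'
        rcases fin2_eq_zero_or_one_q t with rfl | rfl
        · by_cases hℓ : ℓ = j
          · exact ⟨1, i, by rw [hP0, if_pos hℓ, one_smul]⟩
          · exact ⟨0, ℓ, by rw [hP0, if_neg hℓ, zero_smul]⟩
        · by_cases hℓ : ℓ = i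
          · exact ⟨-1, j, by rw [hP1, if_pos hℓ, neg_one_smul]⟩
          · exact ⟨0, ℓ, by rw [hP1, if_neg hℓ, zero_smul]⟩
      · exact ⟨0, ℓ, by rw [hPne _ _ _ hk', zero_smul]⟩
    refine ⟨P, hP0, hP1, hPne, ?_, ?_⟩
    · refine cb.ext fun x => ?_
      obtain ⟨kt, ℓ⟩ := x
      obtain ⟨s, ℓ', hs⟩ := hPt kt ℓ
      rw [Module.End.mul_apply, Module.End.mul_apply, hφcb, map_smul, hs, map_smul, hφcb, smul_comm]
    · have hB : Ψ ∘ₗ P + Ψ.compl₂ P = 0 := by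
        refine LinearMap.BilinForm.ext_basis cb fun x₁ x₂ => ?_
        obtain ⟨⟨k₁, t₁⟩, a⟩ := x₁
        obtain ⟨⟨k₂, t₂⟩, b⟩ := x₂
        rw [LinearMap.add_apply, LinearMap.add_apply, LinearMap.comp_apply, LinearMap.compl₂_apply,
          LinearMap.zero_apply, LinearMap.zero_apply]
        by_cases hk₁ : k₁ = k
        · by_cases hk₂ : k₂ = k
          · rw [hk₁, hk₂]
            rcases fin2_eq_zero_or_one_q t₁ with rfl | rfl <;> rcases fin2_eq_zero_or_one_q t₂ with rfl | rfl
            · rw [hP0, hP0]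
              split_ifs <;> simp [hiso']
            · rw [hP0, hP1]
              by_cases ha : a = j <;> by_cases hb : b = i
              · subst ha; subst hb; simp [hdual_same]
              · subst ha; rw [if_pos rfl, if_neg hb, map_zero, add_zero, hdual_same, if_neg (Ne.symm hb)]
              · subst hb; rw [if_neg ha, if_pos rfl, map_zero, LinearMap.zero_apply, zero_add, map_neg, hdual_same,
                  if_neg ha, neg_zero]
              · rw [if_neg ha, if_neg hb, map_zero, LinearMap.zero_apply, map_zero, add_zero]
            · rw [hP1, hP0]
              by_cases ha : a = i <;> by_cases hb : b = j
              · subst ha; subst hb; simp [hswap_same]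
              · subst ha; rw [if_pos rfl, if_neg hb, map_zero, add_zero, map_neg, LinearMap.neg_apply, hswap_same,
                  if_neg hb, neg_zero, neg_zero]
              · subst hb; rw [if_neg ha, if_pos rfl, map_zero, LinearMap.zero_apply, zero_add, hswap_same,
                  if_neg (Ne.symm ha), neg_zero]
              · rw [if_neg ha, if_neg hb, map_zero, LinearMap.zero_apply, map_zero, add_zero]
            · rw [hP1, hP1]
              split_ifs <;> simp [hiso']
          · -- `x₂` of the other colour: `P x₂ = 0` and `Ψ(colour k, colour k₂) = 0`
            rw [hPne _ _ _ hk₂, map_zero, add_zero, hk₁]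
            obtain ⟨s, ℓ', hs⟩ := hPt (k, t₁) a
            rw [hs, map_smul, LinearMap.smul_apply, hpair0 _ _ _ _ _ _ (Ne.symm hk₂), smul_zero]
        · rw [hPne _ _ _ hk₁, map_zero, LinearMap.zero_apply, zero_add]
          by_cases hk₂ : k₂ = k
          · rw [hk₂]
            obtain ⟨s, ℓ', hs⟩ := hPt (k, t₂) b
            rw [hs, map_smul, hpair0 _ _ _ _ _ _ hk₁, smul_zero]
          · rw [hPne _ _ _ hk₂, map_zero]
      intro x y
      have h := LinearMap.congr_fun (LinearMap.congr_fun hB x) y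
      simpa only [LinearMap.add_apply, LinearMap.comp_apply, LinearMap.compl₂_apply, LinearMap.zero_apply]
        using h
  -- conjugation by the change of basis
  have hYG : ∀ Z : Module.End ℂ (ℂ ⊗[ℚ] bettiCohomology (Y.prod E).X 1), ∀ _t : Fin (2 * p),
      LinearMap.toMatrix eC eC Z * G = G * LinearMap.toMatrix cbσ cbσ Z :=
    fun Z _ => by rw [hG, linearMap_toMatrix_mul_basis_toMatrix, basis_toMatrix_mul_linearMap_toMatrix]
  -- the diagonal weights of `ι_Y D π_Y`, `D = [P^k_{ij}, P^k_{ji}]` for the pairs `Lp = (k,i)`, `Lq = (k,j)` of one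
  -- block: `±([L = Lp] - [L = Lq])` at the `Y`-places (sign `+` iff in `W`), `0` at the `E`-places
  set δ : Fin 4 → Fin 4 → (Fin 4 ⊕ Fin h) → Fin 2 → ℤ := fun Lp Lq T r =>
    Sum.elim (fun L => (if r = κ (e.symm L) then (1 : ℤ) else -1) *
      ((if L = Lp then (1 : ℤ) else 0) - (if L = Lq then 1 else 0))) (fun _ => (0 : ℤ)) T with hδ
  have hax : ∀ Lp Lq : Fin 4, (e.symm Lp).1 = (e.symm Lq).1 → ∀ u : Fin (2 * p) → Fin 1,
      wordDerAt ℂ (fun _ : Fin (2 * p) => blockLift φ (fun T => Matrix.diagonal fun r => ((δ Lp Lq T r : ℤ) : ℂ)))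
        (wordSlice ax u) = 0 := by
    intro Lp Lq hblock u
    -- the block `k` and the members `i`, `j`
    obtain ⟨⟨k, i⟩, hLp⟩ : ∃ ki : Fin 2 × Fin 2, e.symm Lp = ki := ⟨_, rfl⟩
    obtain ⟨⟨k', j⟩, hLq⟩ : ∃ kj : Fin 2 × Fin 2, e.symm Lq = kj := ⟨_, rfl⟩
    rw [hLp, hLq] at hblock
    change k = k' at hblock
    subst hblock
    have hmemP : ∀ L, L = Lp ↔ (e.symm L).1 = k ∧ (e.symm L).2 = i := fun L => by
      constructor
      · rintro rfl
        rw [hLp]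
        exact ⟨rfl, rfl⟩
      · rintro ⟨h₁, h₂⟩
        apply e.symm.injective
        rw [hLp]
        exact Prod.ext h₁ h₂
    have hmemQ : ∀ L, L = Lq ↔ (e.symm L).1 = k ∧ (e.symm L).2 = j := fun L => by
      constructor
      · rintro rfl
        rw [hLq]
        exact ⟨rfl, rfl⟩
      · rintro ⟨h₁, h₂⟩
        apply e.symm.injective
        rw [hLq]
        exact Prod.ext h₁ h₂
    obtain ⟨P, hP0, hP1, hPne, hPφ, hPskew⟩ := hops k i j
    obtain ⟨P', hP'0, hP'1, hP'ne, hP'φ, hP'skew⟩ := hops k j i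
    -- `D` is diagonal on `cb`
    have hD0 : ∀ ℓ, (P * P' - P' * P) (cb ((k, 0), ℓ)) =
        (if ℓ = i then cb ((k, 0), ℓ) else 0) - (if ℓ = j then cb ((k, 0), ℓ) else 0) := by
      intro ℓ
      have hPj : P (cb ((k, 0), j)) = cb ((k, 0), i) := by rw [hP0, if_pos rfl]
      have hP'i : P' (cb ((k, 0), i)) = cb ((k, 0), j) := by rw [hP'0, if_pos rfl]
      rw [LinearMap.sub_apply, Module.End.mul_apply, Module.End.mul_apply, hP'0, hP0]
      by_cases hli : ℓ = i <;> by_cases hlj : ℓ = j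
      · simp only [if_pos hli, if_pos hlj, hPj, hP'i]
        rw [← hli, ← hlj]
      · simp only [if_pos hli, if_neg hlj, hPj, map_zero]
        rw [hli]
      · simp only [if_neg hli, if_pos hlj, hP'i, map_zero]
        rw [hlj]
      · simp only [if_neg hli, if_neg hlj, map_zero, sub_self]
    have hD1 : ∀ ℓ, (P * P' - P' * P) (cb ((k, 1), ℓ)) =
        (if ℓ = j then cb ((k, 1), ℓ) else 0) - (if ℓ = i then cb ((k, 1), ℓ) else 0) := by
      intro ℓ
      have hPi : P (cb ((k, 1), i)) = -cb ((k, 1), j) := by rw [hP1, if_pos rfl]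
      have hP'j : P' (cb ((k, 1), j)) = -cb ((k, 1), i) := by rw [hP'1, if_pos rfl]
      have hPi' : P (-cb ((k, 1), i)) = cb ((k, 1), j) := by rw [map_neg P (cb ((k, 1), i)), hPi, neg_neg]
      have hP'j' : P' (-cb ((k, 1), j)) = cb ((k, 1), i) := by rw [map_neg P' (cb ((k, 1), j)), hP'j, neg_neg]
      rw [LinearMap.sub_apply, Module.End.mul_apply, Module.End.mul_apply, hP'1, hP1]
      by_cases hli : ℓ = i <;> by_cases hlj : ℓ = j
      · simp only [if_pos hli, if_pos hlj, hPi', hP'j']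
        rw [← hli, ← hlj]
      · simp only [if_pos hli, if_neg hlj, map_zero, hP'j']
        rw [hli]
      · simp only [if_neg hli, if_pos hlj, hPi', map_zero]
        rw [hlj]
      · simp only [if_neg hli, if_neg hlj, map_zero, sub_self]
    have hDne : ∀ k' (t : Fin 2) ℓ, k' ≠ k → (P * P' - P' * P) (cb ((k', t), ℓ)) = 0 := fun k' t ℓ hk' => by
      rw [LinearMap.sub_apply, Module.End.mul_apply, Module.End.mul_apply, hP'ne _ _ _ hk', hPne _ _ _ hk', map_zero,
        map_zero, sub_self]
    have hDbY : ∀ L r, (P * P' - P' * P) (bY (L, r)) = ((δ Lp Lq (Sum.inl L) r : ℤ) : ℂ) • bY (L, r) := by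
      intro L r
      rw [hbY]
      by_cases hkL : (e.symm L).1 = k
      · rw [hkL]
        have hiP : (L = Lp) ↔ (e.symm L).2 = i := by rw [hmemP]; exact ⟨fun h => h.2, fun h => ⟨hkL, h⟩⟩
        have hjQ : (L = Lq) ↔ (e.symm L).2 = j := by rw [hmemQ]; exact ⟨fun h => h.2, fun h => ⟨hkL, h⟩⟩
        by_cases hr : r = κ (e.symm L)
        · rw [if_pos hr, hD0, ite_sub_ite_eq_cast_smul_q]
          congr 2
          simp only [hδ, Sum.elim_inl, if_pos hr, one_mul]
          rw [show (if L = Lp then (1 : ℤ) else 0) = (if (e.symm L).2 = i then 1 else 0) from if_congr hiP rfl rfl,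
            show (if L = Lq then (1 : ℤ) else 0) = (if (e.symm L).2 = j then 1 else 0) from if_congr hjQ rfl rfl]
        · rw [if_neg hr, hD1, ite_sub_ite_eq_cast_smul_q]
          congr 2
          simp only [hδ, Sum.elim_inl, if_neg hr]
          rw [show (if L = Lp then (1 : ℤ) else 0) = (if (e.symm L).2 = i then 1 else 0) from if_congr hiP rfl rfl,
            show (if L = Lq then (1 : ℤ) else 0) = (if (e.symm L).2 = j then 1 else 0) from if_congr hjQ rfl rfl]
          ring
      · rw [hDne _ _ _ hkL]
        have hLp' : ¬ L = Lp := fun h => hkL ((hmemP L).1 h).1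
        have hLq' : ¬ L = Lq := fun h => hkL ((hmemQ L).1 h).1
        simp only [hδ, Sum.elim_inl, if_neg hLp', if_neg hLq', sub_self, mul_zero, Int.cast_zero, zero_smul]
    -- the Lie step: `ι_Y D π_Y` kills the rational coefficient tensor
    have hL : wordDerAt ℂ (fun _ : Fin (2 * p) => LinearMap.toMatrix eC eC
          (ι₁.baseChange ℂ ∘ₗ (P * P' - P' * P) ∘ₗ π₁.baseChange ℂ))
        (wordSlice (fun w => algebraMap ℚ ℂ (q' w)) u) = 0 :=
      wordDerAt_incl_bracket_proj_eq_zero_of_quarticUnitary_times_cmCurve hn1 (BettiUniverse.hodge hHD hXP 1)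
        (BettiUniverse.hodge hHD hXA 1) (BettiUniverse.hodge hHD hXC 1) heffA heffC hπι₁ hπι₂ hπ₁ι₂ hπ₂ι₁ hsum
        hι₁F hι₂F ψ ψC hφE hE hdiv h11' h22' h12μ h12μ' hV h1a h1b h2a hχE hd'Q hχ2 hV₂ eQ q' hΘ hΘA hΘC hΘq
        hPφ hPskew hP'φ hP'skew u
    -- the matrix of `Z` in the pair letters is the diagonal block family
    have hblk : LinearMap.toMatrix cbσ cbσ (ι₁.baseChange ℂ ∘ₗ (P * P' - P' * P) ∘ₗ π₁.baseChange ℂ) =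
        blockLift φ (fun T => Matrix.diagonal fun r => ((δ Lp Lq T r : ℤ) : ℂ)) := by
      refine toMatrix_eq_blockLift_of_apply_basis φ cbσ _ _ fun m => ?_
      rw [hcbσ m]
      have hb' : ∀ a, cbσ (φ.symm ((φ m).1, a)) = cbx ((φ m).1, a) := fun a => by
        rw [hcbσ, Equiv.apply_symm_apply]
      simp only [hb']
      obtain ⟨T, r⟩ := φ m
      rw [Finset.sum_eq_single r]
      · rw [Matrix.diagonal_apply_eq]
        rcases T with L | e'
        · simp only [hcbx, Sum.elim_inl]
          rw [LinearMap.comp_apply, LinearMap.comp_apply, e11, hDbY, map_smul]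
        · simp only [hcbx, Sum.elim_inr]
          rw [LinearMap.comp_apply, LinearMap.comp_apply, e12, map_zero, map_zero]
          have h0 : ((δ Lp Lq (Sum.inr e') r : ℤ) : ℂ) = 0 := by simp only [hδ, Sum.elim_inr, Int.cast_zero]
          rw [h0, zero_smul]
      · intro a _ ha
        simp only [Matrix.diagonal_apply_ne _ ha, zero_smul]
      · intro hr; exact absurd (Finset.mem_univ r) hr
    have hLu := hL
    rw [← haEq, hslice_e] at hLu
    have h3 : wordRepAt ℂ (fun _ : Fin (2 * p) => G)
        (wordDerAt ℂ (fun _ : Fin (2 * p) => blockLift φ (fun T => Matrix.diagonal fun r => ((δ Lp Lq T r : ℤ) : ℂ)))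
          (wordSlice ax u)) = 0 := by
      rw [← hblk, wordRepAt_wordDerAt_of_mul_eq ℂ (fun _ : Fin (2 * p) => G) (hYG _), hLu]
    exact wordRepAt_injective ℂ (g := fun _ : Fin (2 * p) => G) (g' := fun _ : Fin (2 * p) => G')
      (funext fun _ => hG'G) (by rw [h3, map_zero])
  -- the coefficient function, refined to slot-and-place colours
  refine ⟨placeRefine φ ax, ?_, fun U η hU => ?_⟩
  · rw [← hcax]
    have hx : (fun jr : (Fin 1 × (Fin 4 ⊕ Fin h)) × Fin 2 => avLetters g v (jr.1.1, φ.symm (jr.1.2, jr.2))) =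
        fun jr : (Fin 1 × (Fin 4 ⊕ Fin h)) × Fin 2 => complexBetti.map (g jr.1.1).hom.hom.hom 1
          (Sum.elim
            (fun i => complexBetti.map (Motives.AbelianVariety.fst Y E).hom.hom.hom 1
              (ofRatClassBaseChange (Motives.ComplexPoints Y.X) 1 (bY (i, jr.2))))
            (fun i => complexBetti.map (Motives.AbelianVariety.snd Y E).hom.hom.hom 1
              (ofRatClassBaseChange (Motives.ComplexPoints E.X) 1 (cC (i, jr.2))))
            jr.1.2) := by
      funext jr
      rw [avLetters_apply, hv_apply, Equiv.apply_symm_apply, hcbx]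
      obtain ⟨⟨j, t⟩, r⟩ := jr
      rcases t with i | i
      · simp only [Sum.elim_inl]
        congr 1
        rw [hι₁, ← ofRatClassBaseChangeEquiv_apply (hX := hXP), ← ofRatClassBaseChangeEquiv_apply (hX := hXA),
          complexBetti_map_ofRatClassBaseChangeEquiv hXP hXA]
      · simp only [Sum.elim_inr]
        congr 1
        rw [hι₂, ← ofRatClassBaseChangeEquiv_apply (hX := hXP), ← ofRatClassBaseChangeEquiv_apply (hX := hXC),
          complexBetti_map_ofRatClassBaseChangeEquiv hXP hXC]
    rw [← hx]
    exact wordEval_placeRefine _ φ (avLetters g v) ax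
  · -- words with a repeated letter: antisymmetry
    by_cases hinjw : Function.Injective (fun t => (U t, η t))
    swap
    · exact (hax_anti.placeRefine φ).apply_eq_zero_of_not_injective hinjw
    -- words without repeated letters: the parity core
    by_contra hne'
    -- `Θ`-balance
    have hval : placeRefine φ ax (fun t => (U t, η t)) = ax (fun t => ((U t).1, φ.symm ((U t).2, η t))) := rfl
    have hbal := hax_bal _ (by rw [← hval]; exact hne')
    have hcnt : ∀ r : Fin 2, (Finset.univ.filter fun t => η t = r).card = p := by
      intro r
      have hb := hbal r
      simp only [wordContent, hκ', Equiv.apply_symm_apply] at hb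
      exact hb
    have hΘw : ∑ t, (if η t = 0 then (1 : ℤ) else -1) = 0 := by
      have h0 := hcnt 0
      have h1 := hcnt 1
      rw [Finset.card_filter] at h0 h1
      have h0' : ∑ t, (if η t = 0 then (1 : ℤ) else 0) = p := by exact_mod_cast h0
      have h1' : ∑ t, (if η t = 1 then (1 : ℤ) else 0) = p := by exact_mod_cast h1
      have hsplit : ∑ t, (if η t = 0 then (1 : ℤ) else -1) =
          ∑ t, (if η t = 0 then (1 : ℤ) else 0) - ∑ t, (if η t = 1 then (1 : ℤ) else 0) := by
        rw [← Finset.sum_sub_distrib]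
        refine Finset.sum_congr rfl fun t _ => ?_
        rcases fin2_eq_zero_or_one_q (η t) with h0'' | h1''
        · simp [h0'']
        · simp [h1'']
      rw [hsplit, h0', h1', sub_self]
    -- in-block root-difference weights
    have hDw : ∀ Lp Lq : Fin 4, (e.symm Lp).1 = (e.symm Lq).1 →
        ∑ t, Sum.elim (fun L => (if η t = κ (e.symm L) then (1 : ℤ) else -1) *
          ((if L = Lp then (1 : ℤ) else 0) - (if L = Lq then (1 : ℤ) else 0))) (fun _ => (0 : ℤ)) (U t).2 = 0 := by
      intro Lp Lq hblock
      have h2 : wordDerAt ℂ (fun t => Matrix.diagonal fun r => ((δ Lp Lq (U t).2 r : ℤ) : ℂ))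
          (wordSlice (placeRefine φ ax) U) = 0 :=
        wordDerAt_placeFamily_placeRefine_eq_zero φ (fun T => Matrix.diagonal fun r => ((δ Lp Lq T r : ℤ) : ℂ))
          (hax Lp Lq hblock) U
      by_contra hw
      refine hne' (eq_zero_of_wordDerAt_diagonal_eq_zero (fun t r => ((δ Lp Lq (U t).2 r : ℤ) : ℂ)) h2 η ?_)
      rw [← Int.cast_sum, Int.cast_ne_zero]
      simpa only [hδ] using hw
    -- injectivity of the place-and-kind word (ONE slot)
    have hinjP : Function.Injective fun t => ((U t).2, η t) := by
      intro t t' htt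
      simp only [Prod.mk.injEq] at htt
      refine hinjw ?_
      simp only [Prod.mk.injEq]
      exact ⟨Prod.ext (Subsingleton.elim _ _) htt.1, htt.2⟩
    have hcore := sum_kindSign_inl_eq_zero_of_blockRootDiffWeights (fun L => κ (e.symm L)) (fun L => (e.symm L).1)
      (fun t => (U t).2) η hinjP (by omega) (even_two_mul p) hβ hΘw hDw
    refine hU ?_
    have hcast : ∀ t, Sum.elim (fun _ : Fin 4 => if η t = 0 then (1 : ℂ) else -1) (fun _ : Fin h => (0 : ℂ)) (U t).2 =
        ((Sum.elim (fun _ : Fin 4 => if η t = 0 then (1 : ℤ) else -1) (fun _ : Fin h => (0 : ℤ)) (U t).2 : ℤ) : ℂ) := by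
      intro t
      rcases (U t).2 with L | e'
      · simp only [Sum.elim_inl]; split_ifs <;> simp
      · simp
    simp only [hcast]
    rw [← Int.cast_sum, hcore, Int.cast_zero]

end Invariance

/-! ### §4 The product span for `Y × E` -/

section ProductSpan

open MonoidalCategory CartesianMonoidalCategory

variable {Y B E Z : AbelianVariety ℂ} {gB : Fin 1 → (B ⟶ Y)} {gE : Fin 1 → (Z ⟶ E)}

/-- **`HodgeClassesProductSpan B Z` for ONE slot over `Y` and ONE slot over `E`**, `Y` a simple fourfold of quartic CM
type `{(1,1),(2,0)}` (`dim_ℚ End⁰(Y) = 4`, `φ` with eigenvalues `μ₁, conj μ₁, μ₂` of multiplicities `1, 1, 2`), `E` an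
elliptic curve with `χ ≫ χ = -d'` — NO condition relating `ℚ(χ)` and `End⁰(Y)` (Moonen–Zarhin Thm. 0.2 (3) with case
(g): «the Hodge ring `B•(X)` is generated by divisor classes»; §5 (5.12): «there are no Hodge classes in `H¹(X₁) ⊗
H³(X₂)`»): every rational `(p,p)`-class on `B × Z` is a `ℂ`-combination of exterior products `pr_B^* a ⌣ pr_Z^* b` of
RATIONAL HODGE classes — the tree's typed-Künneth pipeline (R29
`hodgeClassesProductSpan_of_avSlots_one_of_unitaryTypeOne_cmCurve`, verbatim) fed by the invariance theorem
`AVSlots.exists_coeff_eq_zero_off_balanced_of_prod_quarticCM_cmCurve`.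
[cite: MoonenZarhin1999LowDim, Thm. 0.2 (3) and §5 (5.11)–(5.12)] [cite: MoonenZarhin1999LowDim, §3 (3.1)]
[cite: Lombardo2016, Lemma 3.4 (p. 1229)] -/
theorem hodgeClassesProductSpan_of_avSlots_one_of_quarticCM_cmCurve (hYs : Y.IsSimple) (φY : Y ⟶ Y)
    (hY4e : Module.finrank ℚ Y.endAlgebra = 4) {μ₁ μ₂ : ℂ} (h11 : starRingEnd ℂ μ₁ ≠ μ₁)
    (h22 : starRingEnd ℂ μ₂ ≠ μ₂) (h12 : μ₂ ≠ μ₁) (h12' : μ₂ ≠ starRingEnd ℂ μ₁)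
    (hm1 : eigenMultiplicity Y φY μ₁ = 1) (hm1' : eigenMultiplicity Y φY (starRingEnd ℂ μ₁) = 1)
    (hm2 : eigenMultiplicity Y φY μ₂ = 2) (hY4 : Y.dim = 4)
    (hE1 : E.dim = 1) (χ : E ⟶ E) {d' : ℕ} (hd' : 0 < d') (hχ : χ ≫ χ = -(d' • 𝟙 E))
    (hgB : AVSlots Y B gB) (hgE : AVSlots E Z gE) : HodgeClassesProductSpan B Z := by
  classical
  intro p c hcQ hc
  have hB : IsSmoothProjective B.dim B.X := Motives.AbelianVariety.isSmoothProjective_holds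
  have hZ : IsSmoothProjective Z.dim Z.X := Motives.AbelianVariety.isSmoothProjective_holds
  have hXA : IsSmoothProjective Y.dim Y.X := Motives.AbelianVariety.isSmoothProjective_holds
  have hXC : IsSmoothProjective E.dim E.X := Motives.AbelianVariety.isSmoothProjective_holds
  obtain ⟨hA, bA, h, cC, hbA0, hbA1, hcC0, hcC1, hmain⟩ :=
    (hgB.prodLift hgE).exists_coeff_eq_zero_off_balanced_of_prod_quarticCM_cmCurve hYs φY hY4e h11 h22 h12 h12' hm1
      hm1' hm2 hY4 hE1 χ hd' hχ
  have hc' : IsOfHodgeType (B.prod Z).dim (B.prod Z).X (2 * p) p p c := by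
    rw [Motives.AbelianVariety.dim_prod]; exact hc
  rcases Nat.eq_zero_or_pos p with rfl | hp
  · -- degree `0`: `c = s · 1 = pr_B^*(s · 1_B) ⌣ pr_Z^* 1_Z`
    have h1 : c ∈ Submodule.span ℂ {singularCohomology.one ℂ (ComplexPoints (B.X ⊗ Z.X))} :=
      mem_divisorClassesSpan_zero (N := B.dim + Z.dim) (IsSmoothProjective.tensor_holds hB hZ) c
    obtain ⟨s, hs⟩ := Submodule.mem_span_singleton.1 h1
    refine mem_span_hodgeProductClasses_of_mem_span_pureType B Z hcQ hc (Submodule.subset_span ?_)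
    refine ⟨0, 0, rfl, s • singularCohomology.one ℂ (ComplexPoints B.X), singularCohomology.one ℂ (ComplexPoints Z.X),
      ⟨0, rfl, isOfHodgeType_zero_zero_of_degree_zero hB _⟩,
      ⟨0, 0, rfl, isOfHodgeType_zero_zero_of_degree_zero hZ _⟩, ?_⟩
    rw [← hs, map_smul, LinearMap.map_smul₂]
    erw [singularCohomology.map_one, singularCohomology.map_one, cupProduct_one]
  · obtain ⟨a, hca, hkill⟩ := hmain hp hcQ hc'
    -- the letters of `B × Z` over `Y × E` are `pr_B^*`(letters of `B` over `Y`) and `pr_Z^*`(letters of `Z` over `E`)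
    set xA : (Fin 1 × Fin hA) × Fin 2 → complexBetti B.X 1 := fun jr =>
      complexBetti.map (gB jr.1.1).hom.hom.hom 1 (ofRatClassBaseChange (ComplexPoints Y.X) 1 (bA (jr.1.2, jr.2)))
      with hxA
    set y : (Fin 1 × Fin h) × Fin 2 → complexBetti Z.X 1 := fun jr =>
      complexBetti.map (gE jr.1.1).hom.hom.hom 1 (ofRatClassBaseChange (ComplexPoints E.X) 1 (cC (jr.1.2, jr.2)))
      with hy
    have hletters : (fun jr : (Fin 1 × (Fin hA ⊕ Fin h)) × Fin 2 => complexBetti.map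
        (Motives.AbelianVariety.prodLift (Motives.AbelianVariety.fst B Z ≫ gB jr.1.1)
          (Motives.AbelianVariety.snd B Z ≫ gE jr.1.1)).hom.hom.hom 1
        (Sum.elim
          (fun i => complexBetti.map (Motives.AbelianVariety.fst Y E).hom.hom.hom 1
            (ofRatClassBaseChange (ComplexPoints Y.X) 1 (bA (i, jr.2))))
          (fun i => complexBetti.map (Motives.AbelianVariety.snd Y E).hom.hom.hom 1
            (ofRatClassBaseChange (ComplexPoints E.X) 1 (cC (i, jr.2))))
          jr.1.2)) =
        fun jr : (Fin 1 × (Fin hA ⊕ Fin h)) × Fin 2 => Sum.elim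
          (fun i => complexBetti.map (Motives.AbelianVariety.fst B Z).hom.hom.hom 1 (xA ((jr.1.1, i), jr.2)))
          (fun i => complexBetti.map (Motives.AbelianVariety.snd B Z).hom.hom.hom 1 (y ((jr.1.1, i), jr.2)))
          jr.1.2 := by
      funext jr
      obtain ⟨⟨j, t⟩, κ⟩ := jr
      rcases t with i | i
      · simp only [Sum.elim_inl, hxA]
        rw [complexBetti_map_map_hom, complexBetti_map_map_hom, Motives.AbelianVariety.prodLift_fst]
      · simp only [Sum.elim_inr, hy]
        rw [complexBetti_map_map_hom, complexBetti_map_map_hom, Motives.AbelianVariety.prodLift_snd]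
    -- types of the letters
    have hxA0 : ∀ jr : (Fin 1 × Fin hA) × Fin 2, jr.2 = 0 → IsOfHodgeType B.dim B.X 1 1 0 (xA jr) := by
      rintro ⟨⟨j, i⟩, κ⟩ hκ
      change κ = 0 at hκ
      subst hκ
      exact (hbA0 i).map_of_isSmoothProjective hB hXA _
    have hxA1 : ∀ jr : (Fin 1 × Fin hA) × Fin 2, jr.2 = 1 → IsOfHodgeType B.dim B.X 1 0 1 (xA jr) := by
      rintro ⟨⟨j, i⟩, κ⟩ hκ
      change κ = 1 at hκ
      subst hκ
      exact (hbA1 i).map_of_isSmoothProjective hB hXA _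
    have hy0 : ∀ jr : (Fin 1 × Fin h) × Fin 2, jr.2 = 0 → IsOfHodgeType Z.dim Z.X 1 1 0 (y jr) := by
      rintro ⟨⟨j, i⟩, κ⟩ hκ
      change κ = 0 at hκ
      subst hκ
      exact (hcC0 i).map_of_isSmoothProjective hZ hXC _
    have hy1 : ∀ jr : (Fin 1 × Fin h) × Fin 2, jr.2 = 1 → IsOfHodgeType Z.dim Z.X 1 0 1 (y jr) := by
      rintro ⟨⟨j, i⟩, κ⟩ hκ
      change κ = 1 at hκ
      subst hκ
      exact (hcC1 i).map_of_isSmoothProjective hZ hXC _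
    -- evaluate and feed the typed criterion
    have hmem := wordEval_mem_span_typed_cup_pureType_of_eq_zero_off_balanced
      (Motives.AbelianVariety.fst B Z) (Motives.AbelianVariety.snd B Z) xA y hxA0 hxA1 hy0 hy1 hkill
    rw [← hletters, hca] at hmem
    refine mem_span_hodgeProductClasses_of_mem_span_pureType B Z hcQ hc (Submodule.span_mono ?_ hmem)
    rintro z ⟨i, j, hij, d, μ, hd, hμ, rfl⟩
    exact ⟨i, j, hij, d, μ, hd, hμ, rfl⟩

/-- **`HodgeClassesProductSpan Y E`**: the Hodge classes of `Y × E` are spanned by products of Hodge classes of the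
factors (one slot on each side, `avSlots_self`), `Y` a simple fourfold of quartic CM type `{(1,1),(2,0)}`, `E` an
elliptic curve with complex multiplication (Moonen–Zarhin's case (g) with `End⁰(X₂) = F ⊋ k`).
[cite: MoonenZarhin1999LowDim, Thm. 0.2 (3) and §5 (5.11)–(5.12)] -/
theorem hodgeClassesProductSpan_of_quarticCM_cmCurve (hYs : Y.IsSimple) (φY : Y ⟶ Y)
    (hY4e : Module.finrank ℚ Y.endAlgebra = 4) {μ₁ μ₂ : ℂ} (h11 : starRingEnd ℂ μ₁ ≠ μ₁)
    (h22 : starRingEnd ℂ μ₂ ≠ μ₂) (h12 : μ₂ ≠ μ₁) (h12' : μ₂ ≠ starRingEnd ℂ μ₁)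
    (hm1 : eigenMultiplicity Y φY μ₁ = 1) (hm1' : eigenMultiplicity Y φY (starRingEnd ℂ μ₁) = 1)
    (hm2 : eigenMultiplicity Y φY μ₂ = 2) (hY4 : Y.dim = 4)
    (hE1 : E.dim = 1) (χ : E ⟶ E) {d' : ℕ} (hd' : 0 < d') (hχ : χ ≫ χ = -(d' • 𝟙 E)) :
    HodgeClassesProductSpan Y E :=
  hodgeClassesProductSpan_of_avSlots_one_of_quarticCM_cmCurve hYs φY hY4e h11 h22 h12 h12' hm1 hm1' hm2 hY4 hE1 χ hd'
    hχ (avSlots_self Y) (avSlots_self E)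

end ProductSpan

/-! ### §5 `B•(Y × E) = D•(Y × E)`, the Hodge conjecture for `Y × E`, and Moonen–Zarhin's case (g) with `End⁰(Y) = F` a quartic CM field -/

section DivisorGenerated

open Literature.AlgebraicGeometry.Milne1999 (IsOfCMType)

variable {Y E : AbelianVariety ℂ}

/-- **`B•(Y × E) = D•(Y × E) ⊗ ℂ`** for `Y` a simple fourfold of quartic CM type `{(1,1),(2,0)}` and `E` an elliptic
curve with `χ ≫ χ = -d'` (ANY `d'`): product span (§4) + `B•(Y) = D•(Y)` (the tree's
`AbelianVariety.isDivisorGenerated_of_quarticCM`, Moonen–Zarhin 1995 via MZ99 (2.4)) + `B•(E) = D•(E)` (`dim E ≤ 3`) —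
UNCONDITIONAL. [cite: MoonenZarhin1999LowDim, Thm. 0.2 (3) and §5 (5.12)]
[cite: MoonenZarhin1995Duke, Thm. (0.2) for simple fourfolds (via MZ99 (2.4))] [cite: vanGeemen1994HodgeAV, §2.4–2.5] -/
theorem isDivisorGenerated_prod_cmCurve_of_quarticCM (hYs : Y.IsSimple) (φY : Y ⟶ Y)
    (hY4e : Module.finrank ℚ Y.endAlgebra = 4) {μ₁ μ₂ : ℂ} (h11 : starRingEnd ℂ μ₁ ≠ μ₁)
    (h22 : starRingEnd ℂ μ₂ ≠ μ₂) (h12 : μ₂ ≠ μ₁) (h12' : μ₂ ≠ starRingEnd ℂ μ₁)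
    (hm1 : eigenMultiplicity Y φY μ₁ = 1) (hm1' : eigenMultiplicity Y φY (starRingEnd ℂ μ₁) = 1)
    (hm2 : eigenMultiplicity Y φY μ₂ = 2) (hY4 : Y.dim = 4)
    (hE1 : E.dim = 1) (χ : E ⟶ E) {d' : ℕ} (hd' : 0 < d') (hχ : χ ≫ χ = -(d' • 𝟙 E)) :
    IsDivisorGenerated (Y.prod E) :=
  isDivisorGenerated_prod_of_productSpan Y E
    (hodgeClassesProductSpan_of_quarticCM_cmCurve hYs φY hY4e h11 h22 h12 h12' hm1 hm1' hm2 hY4 hE1 χ hd' hχ)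
    (AbelianVariety.isDivisorGenerated_of_quarticCM Y hYs φY hY4e h11 h22 h12 h12' hm1 hm1' hm2 hY4)
    (isDivisorGenerated_of_dim_le_three E (by omega))

/-- The order `E × Y`: `B•(E × Y) = D•(E × Y) ⊗ ℂ` (isogeny `E × Y ∼ Y × E`).
[cite: MoonenZarhin1999LowDim, Thm. 0.2 (3) and §5 (5.12)] [cite: vanGeemen1994HodgeAV, §3.6 (p. 236)] -/
theorem isDivisorGenerated_cmCurve_prod_of_quarticCM (hYs : Y.IsSimple) (φY : Y ⟶ Y)
    (hY4e : Module.finrank ℚ Y.endAlgebra = 4) {μ₁ μ₂ : ℂ} (h11 : starRingEnd ℂ μ₁ ≠ μ₁)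
    (h22 : starRingEnd ℂ μ₂ ≠ μ₂) (h12 : μ₂ ≠ μ₁) (h12' : μ₂ ≠ starRingEnd ℂ μ₁)
    (hm1 : eigenMultiplicity Y φY μ₁ = 1) (hm1' : eigenMultiplicity Y φY (starRingEnd ℂ μ₁) = 1)
    (hm2 : eigenMultiplicity Y φY μ₂ = 2) (hY4 : Y.dim = 4)
    (hE1 : E.dim = 1) (χ : E ⟶ E) {d' : ℕ} (hd' : 0 < d') (hχ : χ ≫ χ = -(d' • 𝟙 E)) :
    IsDivisorGenerated (E.prod Y) :=
  (isDivisorGenerated_prod_cmCurve_of_quarticCM hYs φY hY4e h11 h22 h12 h12' hm1 hm1' hm2 hY4 hE1 χ hd' hχ).of_isIsogenous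
    (isIsogenous_prod_swap E Y)

/-- **The Hodge conjecture for `Y × E`** — UNCONDITIONAL (`B = D` and Lefschetz `(1,1)`, the tree's
`hodgeConjectureFor_of_isDivisorGenerated`). [cite: MoonenZarhin1999LowDim, Thm. 0.2 (3)] [cite: vanGeemen1994HodgeAV, §2.4] -/
theorem hodgeConjectureFor_prod_cmCurve_of_quarticCM (hYs : Y.IsSimple) (φY : Y ⟶ Y)
    (hY4e : Module.finrank ℚ Y.endAlgebra = 4) {μ₁ μ₂ : ℂ} (h11 : starRingEnd ℂ μ₁ ≠ μ₁)
    (h22 : starRingEnd ℂ μ₂ ≠ μ₂) (h12 : μ₂ ≠ μ₁) (h12' : μ₂ ≠ starRingEnd ℂ μ₁)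
    (hm1 : eigenMultiplicity Y φY μ₁ = 1) (hm1' : eigenMultiplicity Y φY (starRingEnd ℂ μ₁) = 1)
    (hm2 : eigenMultiplicity Y φY μ₂ = 2) (hY4 : Y.dim = 4)
    (hE1 : E.dim = 1) (χ : E ⟶ E) {d' : ℕ} (hd' : 0 < d') (hχ : χ ≫ χ = -(d' • 𝟙 E)) :
    HodgeConjectureFor (Y.prod E).dim (Y.prod E).X :=
  hodgeConjectureFor_of_isDivisorGenerated _
    (isDivisorGenerated_prod_cmCurve_of_quarticCM hYs φY hY4e h11 h22 h12 h12' hm1 hm1' hm2 hY4 hE1 χ hd' hχ)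

/-- **Everything isogenous to `Y × E`** has `B = D` and satisfies the Hodge conjecture (van Geemen §3.6, Lemma 3.7).
[cite: vanGeemen1994HodgeAV, §3.6 (p. 236) and Lemma 3.7] [cite: MoonenZarhin1999LowDim, Thm. 0.2 (3)] -/
theorem hodgeConjectureFor_of_isIsogenous_prod_cmCurve_of_quarticCM {X : AbelianVariety ℂ} (hYs : Y.IsSimple)
    (φY : Y ⟶ Y) (hY4e : Module.finrank ℚ Y.endAlgebra = 4) {μ₁ μ₂ : ℂ} (h11 : starRingEnd ℂ μ₁ ≠ μ₁)
    (h22 : starRingEnd ℂ μ₂ ≠ μ₂) (h12 : μ₂ ≠ μ₁) (h12' : μ₂ ≠ starRingEnd ℂ μ₁)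
    (hm1 : eigenMultiplicity Y φY μ₁ = 1) (hm1' : eigenMultiplicity Y φY (starRingEnd ℂ μ₁) = 1)
    (hm2 : eigenMultiplicity Y φY μ₂ = 2) (hY4 : Y.dim = 4)
    (hE1 : E.dim = 1) (χ : E ⟶ E) {d' : ℕ} (hd' : 0 < d') (hχ : χ ≫ χ = -(d' • 𝟙 E))
    (hX : AbelianVariety.IsIsogenous X (Y.prod E)) :
    IsDivisorGenerated X ∧ HodgeConjectureFor X.dim X.X :=
  have hD := (isDivisorGenerated_prod_cmCurve_of_quarticCM hYs φY hY4e h11 h22 h12 h12' hm1 hm1' hm2 hY4 hE1 χ hd'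
    hχ).of_isIsogenous hX
  ⟨hD, hodgeConjectureFor_of_isDivisorGenerated _ hD⟩

/-- **Moonen–Zarhin 1999 Thm. 0.2 (3), case (g) with `End⁰(X₂) = F` a QUARTIC CM field — a THEOREM**: «(g) The abelian
variety `X` is isogenous to a product `X₁ × X₂` where `X₁` is an elliptic curve with complex multiplication by an
imaginary quadratic field `k` and where `X₂` is a simple abelian fourfold such that there exists an embedding
`k ↪ End⁰(X₂)` via which `k` acts on `T_{X₂,0}` with multiplicities `(1,3)` … (5.11) Write `F = End⁰(Y)`, which is a
CM-field containing `k` … (3) Suppose we are in case (g). Then the Hodge ring `B•(X)` is generated by divisor classes,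
i.e., `B•(X) = D•(X)`», here for `X₂` simple with `dim_ℚ End⁰(X₂) = 4` and `φ ∈ End(X₂)` acting on `H^{1,0}(X₂)` with
the eigenvalues `μ₁, conj μ₁` (once each), `μ₂` (twice), `μ₁, conj μ₁, μ₂, conj μ₂` pairwise distinct (`F = ℚ(φ)`
quartic of signature `{(1,1),(2,0)}` — the `F`-signature of «`k` acts with multiplicities `(1,3)`»), and `X₁` ANY
elliptic curve of CM type (the embedding `k ↪ F` is not needed). UNCONDITIONAL; with the Hodge conjecture for `X`.
-- TODO(general form): the translation «`End⁰(X₂)` a quartic field ∋ `φ` central of `k`-multiplicities `(1,3)`» ⟹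
-- these data, and `End⁰(X₂)` of degree `8`, are not covered here.
[cite: MoonenZarhin1999LowDim, Thm. 0.2 (3) with case (g) and §5 (5.11) Case 2, (5.12)] -/
theorem isDivisorGenerated_of_isIsogenous_cmCurve_prod_fourfold_caseG_quarticCM {X X₁ X₂ : AbelianVariety ℂ}
    (hX₁ : X₁.dim = 1) (hX₁cm : IsOfCMType X₁) (hX₂s : X₂.IsSimple) (hX₂ : X₂.dim = 4)
    (hX₂e : Module.finrank ℚ X₂.endAlgebra = 4) (φ : X₂ ⟶ X₂) {μ₁ μ₂ : ℂ} (h11 : starRingEnd ℂ μ₁ ≠ μ₁)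
    (h22 : starRingEnd ℂ μ₂ ≠ μ₂) (h12 : μ₂ ≠ μ₁) (h12' : μ₂ ≠ starRingEnd ℂ μ₁)
    (hm1 : eigenMultiplicity X₂ φ μ₁ = 1) (hm1' : eigenMultiplicity X₂ φ (starRingEnd ℂ μ₁) = 1)
    (hm2 : eigenMultiplicity X₂ φ μ₂ = 2) (hX : AbelianVariety.IsIsogenous X (X₁.prod X₂)) :
    IsDivisorGenerated X ∧ HodgeConjectureFor X.dim X.X := by
  obtain ⟨χ, d', hd', hχ⟩ := exists_hom_comp_self_eq_neg_of_cmCurve hX₁ hX₁cm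
  have hD := (isDivisorGenerated_cmCurve_prod_of_quarticCM hX₂s φ hX₂e h11 h22 h12 h12' hm1 hm1' hm2 hX₂ hX₁ χ hd'
    hχ).of_isIsogenous hX
  exact ⟨hD, hodgeConjectureFor_of_isDivisorGenerated _ hD⟩

/-- **`B•(Y × E) = D•(Y × E) ⊗ ℂ` for EVERY elliptic curve `E`**, `Y` a simple fourfold of quartic CM type
`{(1,1),(2,0)}`: `E` not of CM type ⟹ `Hom(Y, E) = 0` (simple, different dimensions) and the tree's
`hodgeClassesProductSpan_of_nonCMCurve_of_forall_hom_eq_zero` (Moonen–Zarhin Lemma (3.4) / Prop. (3.8): «either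
`Hg(X × E) = Hg(X) × Hg(E)` or `End⁰(E) = k` is an imaginary quadratic field …»); `E` of CM type ⟹
`isDivisorGenerated_prod_cmCurve_of_quarticCM` (ANY `k`, inside `F` or not).
[cite: MoonenZarhin1999LowDim, Thm. 0.2 (3)–(4) and §3 Lemma (3.4), Prop. (3.8)] [cite: SilvermanAEC2009, III.9 Cor. 9.4] -/
theorem isDivisorGenerated_prod_curve_of_quarticCM (hYs : Y.IsSimple) (φY : Y ⟶ Y)
    (hY4e : Module.finrank ℚ Y.endAlgebra = 4) {μ₁ μ₂ : ℂ} (h11 : starRingEnd ℂ μ₁ ≠ μ₁)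
    (h22 : starRingEnd ℂ μ₂ ≠ μ₂) (h12 : μ₂ ≠ μ₁) (h12' : μ₂ ≠ starRingEnd ℂ μ₁)
    (hm1 : eigenMultiplicity Y φY μ₁ = 1) (hm1' : eigenMultiplicity Y φY (starRingEnd ℂ μ₁) = 1)
    (hm2 : eigenMultiplicity Y φY μ₂ = 2) (hY4 : Y.dim = 4) (hE1 : E.dim = 1) : IsDivisorGenerated (Y.prod E) := by
  open Literature.NumberTheory.ComplexMultiplication in
  rcases finrank_endAlgebra_eq_one_or_two (A₀ := E) hE1 with h1 | h2
  · exact isDivisorGenerated_prod_of_productSpan Y E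
      (hodgeClassesProductSpan_of_nonCMCurve_of_forall_hom_eq_zero hE1 h1 fun u =>
        hom_eq_zero_of_isSimple_of_dim_ne hYs (Motives.AbelianVariety.isSimple_of_dim_le_one hE1.le) (by omega) u)
      (AbelianVariety.isDivisorGenerated_of_quarticCM Y hYs φY hY4e h11 h22 h12 h12' hm1 hm1' hm2 hY4)
      (isDivisorGenerated_of_dim_le_three E (by omega))
  · open Literature.NumberTheory.ComplexMultiplication in
    have hEcm : IsOfCMType E := (EllipticCurve.isOfCMType_iff_finrank_end_eq_two hE1).2
      (by rw [AbelianVariety.finrank_int_end_eq_finrank_endAlgebra]; exact h2)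
    obtain ⟨χ, d', hd', hχ⟩ := exists_hom_comp_self_eq_neg_of_cmCurve hE1 hEcm
    exact isDivisorGenerated_prod_cmCurve_of_quarticCM hYs φY hY4e h11 h22 h12 h12' hm1 hm1' hm2 hY4 hE1 χ hd' hχ

/-- **The Hodge conjecture for everything isogenous to `Y × E`, `E` ANY elliptic curve**, `Y` a simple fourfold of
quartic CM type `{(1,1),(2,0)}` (with `B = D`). For `E` of CM type by `k ⊂ F = End⁰(Y)` this is Thm. 0.2 (3) (case (g)
with `End⁰(X₂) = F` quartic); otherwise Thm. 0.2 (4).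
[cite: MoonenZarhin1999LowDim, Thm. 0.2 (3)–(4) and §3 Prop. (3.8)] [cite: vanGeemen1994HodgeAV, §3.6 (p. 236) and Lemma 3.7] -/
theorem hodgeConjectureFor_of_isIsogenous_prod_curve_of_quarticCM {X : AbelianVariety ℂ} (hYs : Y.IsSimple)
    (φY : Y ⟶ Y) (hY4e : Module.finrank ℚ Y.endAlgebra = 4) {μ₁ μ₂ : ℂ} (h11 : starRingEnd ℂ μ₁ ≠ μ₁)
    (h22 : starRingEnd ℂ μ₂ ≠ μ₂) (h12 : μ₂ ≠ μ₁) (h12' : μ₂ ≠ starRingEnd ℂ μ₁)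
    (hm1 : eigenMultiplicity Y φY μ₁ = 1) (hm1' : eigenMultiplicity Y φY (starRingEnd ℂ μ₁) = 1)
    (hm2 : eigenMultiplicity Y φY μ₂ = 2) (hY4 : Y.dim = 4) (hE1 : E.dim = 1)
    (hX : AbelianVariety.IsIsogenous X (Y.prod E)) :
    IsDivisorGenerated X ∧ HodgeConjectureFor X.dim X.X :=
  have hD := (isDivisorGenerated_prod_curve_of_quarticCM hYs φY hY4e h11 h22 h12 h12' hm1 hm1' hm2 hY4 hE1).of_isIsogenous
    hX
  ⟨hD, hodgeConjectureFor_of_isDivisorGenerated _ hD⟩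

/- **On path**: the Hodge conjecture gives every target of this file (the tree's `hodgeConjectureFor_prod_of_hodgeConjecture'`);
this file proves them unconditionally. -/
example (h : ∀ ⦃n : ℕ⦄ ⦃S : Literature.AlgebraicGeometry.Motives.SchemeOver ℂ⦄,
      Literature.AlgebraicGeometry.Motives.IsSmoothProjective n S → HodgeConjectureFor n S) (X : AbelianVariety ℂ) :
    HodgeConjectureFor X.dim X.X :=
  h Literature.AlgebraicGeometry.Motives.AbelianVariety.isSmoothProjective_holds

end DivisorGenerated

end Literature.AlgebraicGeometry.HodgeTheory

end
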